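import Mathlib
import Literature.MathematicalPhysics.QuantumFieldTheory.Balaban1983to89.B16Sect1Wilson
import Literature.MathematicalPhysics.QuantumFieldTheory.Balaban1983to89.B16Sect1Statements
import Literature.MathematicalPhysics.QuantumFieldTheory.Balaban1983to89.B14FlowStep

/-!
# `Balaban1983to89.B16Sect1SmallFactors` — T. Bałaban, *Large field renormalization. II. Localization, exponentiation,
and bounds for the 𝐑 operation*, Commun. Math. Phys. **122**, 355–392 (1989), doi:10.1007/bf01238433
[Balaban1989LargeFieldII] (cell paper B16; PDF held `paper:balaban1989-cmp122-large-field-ii`, journal page = PDF page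
+ 354): the «small for g_k small enough» and «small under the conditions on N» CLAUSES of §1, pp. 357–368 and p. 379,
PROVED from the dictionary of T. Bałaban, *Convergent renormalization expansions for lattice gauge theories*, Commun.
Math. Phys. **119**, 243–285 (1988) [Balaban1988Convergent] = [III], (2.4)–(2.5) p. 255 (mega-formalization
`lit-balaban`, reader/typer block r13, generation 8; SKELETON rows B16.Eq1.6, B16.Txt@361V, B16.Txt@362, B16.Txt@363,
B16.Lem@363, B16.Eq1.29, B16.Eq1.31, B16.Lem@366, B16.Eq1.47, B16.Lem@379; §9: B16.Eq1.28 and the bridge from the tree's typed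
(2.5) [III] `B14.IsRj`; §10: B16.Eq1.9, B16.Eq1.77).

Statement-level skeleton of published theorems with citation tags; proofs where landed; nothing here is a claim about the Yang–Mills mass gap.

WHAT IS HERE.  The sibling modules `…B16Sect1Wilson`, `…B16Sect1Kernels`, `…B16Sect1Statements` typed the in-text
bounds of §1 and PROVED every printed arithmetic chain, leaving each concluding clause — *"if g_k is small enough"*,
*"can be made arbitrarily small for g_k small enough"*, *"small if L^{−N} is small enough … we need ν ≧ 2p₀ + dr₀"*,
*"small under the usual conditions on N"* — as prose in a docstring.  This module proves those clauses as real
analysis, reading the letters through [III] p. 255: *"ε_j = g_jA₀(log g_j⁻²)^{p₀} = g_jp₀(g_j); (2.4) R_j is the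
smallest number of the form L^r such, that R_j ≧ (log g_j⁻²)^r. (2.5)"* (render
`1988-cmp119-convergent-renormalization-p013-x4.png` re-read by this seat).  With `ℓ = log g_k⁻²` the profiles are
`p₀(g_k) = ℓ^{p₀}`, `p₁(g_k) = ℓ^{p₁}`, `q₀(g_k) = ℓ^{q₀}`, `q₁(g_k) = ℓ^{q₁}` (the siblings' convention `ε_k =
g_kA₀p₀(g_k)`, `δ′_k = g_kA₁p₁(g_k)`, B16 (1.6) p. 357), `ℓ^{r₀} ≦ R_k ≦ Lℓ^{r₀}` (both halves of (2.5)), and `g_k =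
exp(−ℓ/2)`.  Every «small for g_k small» clause becomes `∀ τ > 0, ∃ g₀ > 0, ∀ g_k ∈ (0, g₀], … ≦ τ` (the threshold
`g₀` depending on the other letters, as in print), proved from the two Mathlib limits `x^s·e^{−bx} → 0` and `x^{−κ} →
0`; every «conditions on N» clause becomes an explicit non-positive power of `ℓ` obtained from the N-window
`B16Sect1Kernels.NWindowLower`/`NWindowUpper` and the printed exponent condition `B16Sect1Kernels.NuCondition363`
(for (1.47) the condition the text leaves as «the usual conditions on N» is made explicit, cell GAPS G-B16-03).
Nothing else is asserted: the bounded quantities stay the real letters of the siblings' `Prop`s, and the geometry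
behind the counts (`|𝐁₀| ≦ (100MR_k)^dN²`, …) stays where the siblings put it.

§9 (v1.1): `dict_of_isRj` derives both dictionary halves `ℓ^r ≦ R_k ≦ Lℓ^r` from the tree's typed (2.5) [III]
`B14.IsRj L r g_k R_k` (upper half = minimality, `B14FlowStep.isRj_le_mul_logpow`), `ineq16_abs_lt_one_of_isRj` shows
the knit on row B16.Eq1.6, and `ineq128first_small` proves p. 363 *"Thus the first order term of this expansion is
small"* for the bound `B16Sect1Statements.Ineq128first` (the factor `exp(−δMR_{h+1})` of (1.23)).
§10 (v1.2): p. 358 *"(1.9) for g_k sufficiently small"* — the explicit smallness hypothesis of the sibling's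
`B16Sect1Wilson.ineq19_of_17_18` discharged (`ineq17_correction_small`, `ineq19_of_17_18_small`) — and p. 383 *"We
assume that g_j is sufficiently small, so that the constant on the right-hand side [of (1.77)] is small, or O(1)"*
(`ineq177_const_small`, `ineq177_lower_of_small`).

Renders re-read by this seat: `run/shared/lean/pub/pub-balaban/b2b-balaban-ref1/pages/1989-cmp122-large-field-II/`
p003, p007, p008, p009, p010, p012, p014, p025 (journal pp. 357, 361–364, 366, 368, 379) and [III] p013 (p. 255).
-/

namespace Literature.MathematicalPhysics.QuantumFieldTheory.Balaban1983to89.B16Sect1SmallFactors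

open Real Filter
open Literature.MathematicalPhysics.QuantumFieldTheory.Balaban1983to89

/-! ## §0. The [III] (2.4)–(2.5) dictionary at one scale and the two decay lemmas everything below reduces to -/

/-- `ℓ = log g⁻²` inverts to `g = exp(−ℓ/2)` for `g > 0`. [cite: Balaban1988Convergent, (2.4) p.255] -/
theorem g_eq_exp_of_ell {g ℓ : ℝ} (hg : 0 < g) (hℓ : ℓ = Real.log (g ^ 2)⁻¹) : g = Real.exp (-(ℓ / 2)) := by
  have h1 : ℓ = -(2 * Real.log g) := by
    rw [hℓ, Real.log_inv, Real.log_pow]; push_cast; ring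
  have h2 : -(ℓ / 2) = Real.log g := by rw [h1]; ring
  rw [h2, Real.exp_log hg]

/-- `g²` in the dictionary: `g² = exp(−ℓ)`. [cite: Balaban1988Convergent, (2.4) p.255] -/
theorem gsq_eq_exp_of_ell {g ℓ : ℝ} (hg : 0 < g) (hℓ : ℓ = Real.log (g ^ 2)⁻¹) : g ^ 2 = Real.exp (-ℓ) := by
  rw [g_eq_exp_of_ell hg hℓ, ← Real.exp_nat_mul]; congr 1; push_cast; ring

/-- Thresholds in `ℓ` are thresholds in `g`: `0 < g ≦ exp(−ℓ₀/2)` gives `ℓ₀ ≦ log g⁻²` — the form in which «for g_k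
small enough» is used below. [cite: Balaban1988Convergent, (2.4) p.255] -/
theorem ell_ge_of_g_le {g ℓ₀ : ℝ} (hg : 0 < g) (hle : g ≤ Real.exp (-(ℓ₀ / 2))) : ℓ₀ ≤ Real.log (g ^ 2)⁻¹ := by
  have h1 : Real.log g ≤ -(ℓ₀ / 2) := (Real.log_le_iff_le_exp hg).mpr hle
  rw [Real.log_inv, Real.log_pow]; push_cast; linarith

/-- A real power of a real power, natural outer exponent: `(ℓ^a)^n = ℓ^{a·n}` (`ℓ ≥ 0`). [folklore] -/
private theorem rpow_pow_eq {ℓ : ℝ} (hℓ : 0 ≤ ℓ) (a : ℝ) (n : ℕ) : (ℓ ^ a) ^ n = ℓ ^ (a * n) := by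
  rw [← Real.rpow_natCast, ← Real.rpow_mul hℓ]

/-- For `ℓ ≥ 1` real powers are monotone in the exponent (Mathlib), recorded in the form used below. [folklore] -/
private theorem rpow_le_rpow_of_le {ℓ a b : ℝ} (hℓ : 1 ≤ ℓ) (hab : a ≤ b) : ℓ ^ a ≤ ℓ ^ b :=
  Real.rpow_le_rpow_of_exponent_le hℓ hab

/-- For `ℓ ≥ 1` and `r₀ ≥ 1`: `ℓ ≦ ℓ^{r₀}` — so `R_k ≧ ℓ` under (2.5) with `r ≥ 1` ([III] p. 246: the exponent `r` of
`R_k` is at least `1`). [cite: Balaban1988Convergent, (2.5) p.255] -/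
theorem ell_le_rpow {ℓ r₀ : ℝ} (hℓ : 1 ≤ ℓ) (hr : 1 ≤ r₀) : ℓ ≤ ℓ ^ r₀ := by
  calc ℓ = ℓ ^ (1 : ℝ) := (Real.rpow_one ℓ).symm
    _ ≤ ℓ ^ r₀ := Real.rpow_le_rpow_of_exponent_le hℓ hr

/-- **Decay lemma 1** (polylog × exponential): for every constant `K`, real power `a` and rate `c > 0`, and every `τ >
0`, there is `ℓ₀ ≥ 1` with `|K|·ℓ^a·exp(−cℓ) ≦ τ` for all `ℓ ≥ ℓ₀` (Mathlib: `x^s·e^{−bx} → 0`).  Every «small for g_k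
small» clause below is an instance (`g_k = e^{−ℓ/2}`, `g_k² = e^{−ℓ}`, `e^{−R_k} ≦ e^{−ℓ}`). [folklore] -/
private theorem decay_small (K a c : ℝ) (hc : 0 < c) {τ : ℝ} (hτ : 0 < τ) :
    ∃ ℓ₀ : ℝ, 1 ≤ ℓ₀ ∧ ∀ ℓ, ℓ₀ ≤ ℓ → |K| * ℓ ^ a * Real.exp (-(c * ℓ)) ≤ τ := by
  have ht := tendsto_rpow_mul_exp_neg_mul_atTop_nhds_zero a c hc
  have hε : (0 : ℝ) < τ / (|K| + 1) := div_pos hτ (by positivity)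
  have hev : ∀ᶠ x : ℝ in atTop, x ^ a * Real.exp (-c * x) ≤ τ / (|K| + 1) := ht.eventually (eventually_le_nhds hε)
  obtain ⟨x₀, hx₀⟩ := eventually_atTop.1 hev
  refine ⟨max x₀ 1, le_max_right _ _, fun ℓ hℓ => ?_⟩
  have hx : ℓ ^ a * Real.exp (-c * ℓ) ≤ τ / (|K| + 1) := hx₀ ℓ (le_trans (le_max_left _ _) hℓ)
  have hℓ0 : 0 ≤ ℓ := le_trans (le_trans zero_le_one (le_max_right x₀ 1)) hℓ
  have hK : 0 ≤ |K| := abs_nonneg K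
  calc |K| * ℓ ^ a * Real.exp (-(c * ℓ)) = |K| * (ℓ ^ a * Real.exp (-c * ℓ)) := by rw [neg_mul]; ring
    _ ≤ |K| * (τ / (|K| + 1)) := mul_le_mul_of_nonneg_left hx hK
    _ ≤ (|K| + 1) * (τ / (|K| + 1)) := mul_le_mul_of_nonneg_right (by linarith) hε.le
    _ = τ := by field_simp

/-- **Decay lemma 2** (negative powers): for `κ > 0`, `K ≥ 0` and every `τ > 0` there is `ℓ₀ ≥ 1` with `K·ℓ^{−κ} ≦ τ`
for `ℓ ≥ ℓ₀` (Mathlib: `x^{−κ} → 0`).  The «conditions on N» clauses land on `K·ℓ^{−κ}`. [folklore] -/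
private theorem rpow_neg_small (K κ : ℝ) (hκ : 0 < κ) {τ : ℝ} (hτ : 0 < τ) :
    ∃ ℓ₀ : ℝ, 1 ≤ ℓ₀ ∧ ∀ ℓ, ℓ₀ ≤ ℓ → |K| * ℓ ^ (-κ) ≤ τ := by
  have ht := tendsto_rpow_neg_atTop hκ
  have hε : (0 : ℝ) < τ / (|K| + 1) := div_pos hτ (by positivity)
  have hev : ∀ᶠ x : ℝ in atTop, x ^ (-κ) ≤ τ / (|K| + 1) := ht.eventually (eventually_le_nhds hε)
  obtain ⟨x₀, hx₀⟩ := eventually_atTop.1 hev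
  refine ⟨max x₀ 1, le_max_right _ _, fun ℓ hℓ => ?_⟩
  have hx : ℓ ^ (-κ) ≤ τ / (|K| + 1) := hx₀ ℓ (le_trans (le_max_left _ _) hℓ)
  have hK : 0 ≤ |K| := abs_nonneg K
  calc |K| * ℓ ^ (-κ) ≤ |K| * (τ / (|K| + 1)) := mul_le_mul_of_nonneg_left hx hK
    _ ≤ (|K| + 1) * (τ / (|K| + 1)) := mul_le_mul_of_nonneg_right (by linarith) hε.le
    _ = τ := by field_simp


/-- The bookkeeping step shared by all «small for g_k small» clauses: a quantity `K·ℓ^a·D` whose last factor is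
dominated by `e^{−cℓ}` is at most `|K|·ℓ^a·e^{−cℓ}`. [folklore] -/
private theorem bound_by_decay {K a D ℓ c : ℝ} (hℓ : 0 ≤ ℓ) (hD0 : 0 ≤ D) (hD : D ≤ Real.exp (-(c * ℓ))) :
    K * ℓ ^ a * D ≤ |K| * ℓ ^ a * Real.exp (-(c * ℓ)) := by
  have h1 : K * ℓ ^ a * D ≤ |K| * ℓ ^ a * D :=
    mul_le_mul_of_nonneg_right (mul_le_mul_of_nonneg_right (le_abs_self K) (Real.rpow_nonneg hℓ a)) hD0
  exact h1.trans (mul_le_mul_of_nonneg_left hD (mul_nonneg (abs_nonneg K) (Real.rpow_nonneg hℓ a)))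

/-! ## §1. p. 357, (1.6): «it is enough to have an absolute bound, e.g., the number 1» (row B16.Eq1.6) -/

/-- **(1.6) p. 357 [3]** (render p003), verbatim: *"… < 3B₃M₀A₀²p₀²(g_k)exp(−R_k)(100M)⁴, (1.6) where we have used the
fact that Λ is contained in a cube of the size 100M. The bound on the right-hand side above can be made arbitrarily
small for sufficiently small g_k, but it is enough to have an absolute bound, e.g., the number 1."* — PROVED: for every
`τ > 0` (in particular `τ = 1`) there is `g₀ > 0` such that the right-hand side of `B16Sect1Wilson.Ineq16` is `≦ τ`
whenever `0 < g_k ≦ g₀` (dictionary `p₀(g_k) = ℓ^{p₀}`, `R_k ≧ ℓ^{r₀}`, `r₀ ≧ 1`). [cite: Balaban1989LargeFieldII, (1.6) p.357] -/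
theorem ineq16_rhs_small (B₃ M₀ A₀ M p₀ r₀ : ℝ) (hr₀ : 1 ≤ r₀) {τ : ℝ} (hτ : 0 < τ) :
    ∃ g₀ : ℝ, 0 < g₀ ∧ ∀ gk ℓ Rk p₀g : ℝ, 0 < gk → ℓ = Real.log (gk ^ 2)⁻¹ → ℓ ^ r₀ ≤ Rk → gk ≤ g₀ →
      p₀g = ℓ ^ p₀ → 3 * B₃ * M₀ * A₀ ^ 2 * p₀g ^ 2 * Real.exp (-Rk) * (100 * M) ^ 4 ≤ τ := by
  obtain ⟨ℓ₀, hℓ₀1, hℓ₀⟩ := decay_small (3 * B₃ * M₀ * A₀ ^ 2 * (100 * M) ^ 4) (p₀ * 2) 1 one_pos hτ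
  refine ⟨Real.exp (-(ℓ₀ / 2)), Real.exp_pos _, fun gk ℓ Rk p₀g hg0 hℓeq hRlo hg hp => ?_⟩
  have hℓ : ℓ₀ ≤ ℓ := by rw [hℓeq]; exact ell_ge_of_g_le hg0 hg
  have hℓ1 : 1 ≤ ℓ := le_trans hℓ₀1 hℓ
  have hR : ℓ ≤ Rk := le_trans (ell_le_rpow hℓ1 hr₀) hRlo
  have hexp : Real.exp (-Rk) ≤ Real.exp (-(1 * ℓ)) := Real.exp_le_exp.mpr (by linarith)
  have hp2 : p₀g ^ 2 = ℓ ^ (p₀ * 2) := by rw [hp, rpow_pow_eq (by linarith) p₀ 2]; norm_num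
  calc 3 * B₃ * M₀ * A₀ ^ 2 * p₀g ^ 2 * Real.exp (-Rk) * (100 * M) ^ 4
      = (3 * B₃ * M₀ * A₀ ^ 2 * (100 * M) ^ 4) * ℓ ^ (p₀ * 2) * Real.exp (-Rk) := by rw [hp2]; ring
    _ ≤ |3 * B₃ * M₀ * A₀ ^ 2 * (100 * M) ^ 4| * ℓ ^ (p₀ * 2) * Real.exp (-(1 * ℓ)) :=
        bound_by_decay (by linarith) (Real.exp_pos _).le hexp
    _ ≤ τ := hℓ₀ ℓ hℓ

/-- The printed instance *"e.g., the number 1"*: `Ineq16` then gives `|T| < 1` for `g_k` small. [cite: Balaban1989LargeFieldII, (1.6) p.357] -/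
theorem ineq16_abs_lt_one (B₃ M₀ A₀ M p₀ r₀ : ℝ) (hr₀ : 1 ≤ r₀) :
    ∃ g₀ : ℝ, 0 < g₀ ∧ ∀ gk ℓ Rk p₀g T : ℝ, 0 < gk → ℓ = Real.log (gk ^ 2)⁻¹ → ℓ ^ r₀ ≤ Rk → gk ≤ g₀ →
      p₀g = ℓ ^ p₀ → B16Sect1Wilson.Ineq16 T B₃ M₀ A₀ p₀g Rk M → |T| < 1 := by
  obtain ⟨g₀, hg₀, h⟩ := ineq16_rhs_small B₃ M₀ A₀ M p₀ r₀ hr₀ one_pos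
  exact ⟨g₀, hg₀, fun gk ℓ Rk p₀g T hg0 hℓeq hRlo hg hp h16 =>
    lt_of_lt_of_le h16 (h gk ℓ Rk p₀g hg0 hℓeq hRlo hg hp)⟩

/-! ## §2. p. 361: the third-order term and the small quadratic terms of (1.20) (row B16.Txt@361V) -/

/-- **p. 361 [7]** (render p007), the `V`-term of (1.20): *"… ≦ g_k³O(1)M^dR_k^{d+2}A₁³p₁³(g_k), and dividing the
number on the right-hand side by g_k² we get still a small number, if g_k is small enough."* — PROVED for the right-hand
side of `B16Sect1Statements.ineq120V_arith` (its `O(1)` = `C·100^d`): divided by `g_k²` it is `≦ τ` for `0 < g_k ≦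
g₀(τ, …)` (dictionary `p₁(g_k) = ℓ^{p₁}`, `R_k ≦ Lℓ^{r₀}`, `g_k = e^{−ℓ/2}`). [cite: Balaban1989LargeFieldII, (1.20) p.361] -/
theorem ineq120V_small (C M A₁ L p₁ r₀ : ℝ) (d : ℕ) (hC : 0 ≤ C) (hM : 0 ≤ M) (hA₁ : 0 ≤ A₁)
    {τ : ℝ} (hτ : 0 < τ) :
    ∃ g₀ : ℝ, 0 < g₀ ∧ ∀ gk ℓ Rk p₁g : ℝ, 0 < gk → ℓ = Real.log (gk ^ 2)⁻¹ →
      ℓ ^ r₀ ≤ Rk → Rk ≤ L * ℓ ^ r₀ → gk ≤ g₀ → p₁g = ℓ ^ p₁ →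
      (gk ^ 2)⁻¹ * (gk ^ 3 * (C * 100 ^ d) * M ^ d * Rk ^ (d + 2) * A₁ ^ 3 * p₁g ^ 3) ≤ τ := by
  obtain ⟨ℓ₀, hℓ₀1, hℓ₀⟩ :=
    decay_small (C * 100 ^ d * M ^ d * L ^ (d + 2) * A₁ ^ 3) (r₀ * (d + 2 : ℕ) + p₁ * (3 : ℕ)) (1 / 2)
      (by norm_num) hτ
  refine ⟨Real.exp (-(ℓ₀ / 2)), Real.exp_pos _, fun gk ℓ Rk p₁g hg0 hℓeq hRlo hRhi hg hp => ?_⟩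
  have hℓ : ℓ₀ ≤ ℓ := by rw [hℓeq]; exact ell_ge_of_g_le hg0 hg
  have hℓ0 : 0 < ℓ := by linarith
  have hRk : 0 ≤ Rk := le_trans (Real.rpow_nonneg hℓ0.le r₀) hRlo
  have hRpow : Rk ^ (d + 2) ≤ (L * ℓ ^ r₀) ^ (d + 2) := pow_le_pow_left₀ hRk hRhi _
  have e1 : (gk ^ 2)⁻¹ * (gk ^ 3 * (C * 100 ^ d) * M ^ d * Rk ^ (d + 2) * A₁ ^ 3 * p₁g ^ 3) =
      (C * 100 ^ d * M ^ d * A₁ ^ 3 * p₁g ^ 3) * Rk ^ (d + 2) * gk := by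
    field_simp
  have e2 : (C * 100 ^ d * M ^ d * A₁ ^ 3 * p₁g ^ 3) * (L * ℓ ^ r₀) ^ (d + 2) * gk =
      (C * 100 ^ d * M ^ d * L ^ (d + 2) * A₁ ^ 3) * ℓ ^ (r₀ * (d + 2 : ℕ) + p₁ * (3 : ℕ)) *
        Real.exp (-(1 / 2 * ℓ)) := by
    rw [hp, mul_pow, Real.rpow_add hℓ0, ← rpow_pow_eq hℓ0.le, ← rpow_pow_eq hℓ0.le, g_eq_exp_of_ell hg0 hℓeq]
    ring_nf
  calc (gk ^ 2)⁻¹ * (gk ^ 3 * (C * 100 ^ d) * M ^ d * Rk ^ (d + 2) * A₁ ^ 3 * p₁g ^ 3)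
      = (C * 100 ^ d * M ^ d * A₁ ^ 3 * p₁g ^ 3) * Rk ^ (d + 2) * gk := e1
    _ ≤ (C * 100 ^ d * M ^ d * A₁ ^ 3 * p₁g ^ 3) * (L * ℓ ^ r₀) ^ (d + 2) * gk := by
        have hp0 : 0 ≤ p₁g := by rw [hp]; exact Real.rpow_nonneg hℓ0.le _
        exact mul_le_mul_of_nonneg_right (mul_le_mul_of_nonneg_left hRpow (by positivity)) hg0.le
    _ = (C * 100 ^ d * M ^ d * L ^ (d + 2) * A₁ ^ 3) * ℓ ^ (r₀ * (d + 2 : ℕ) + p₁ * (3 : ℕ)) *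
        Real.exp (-(1 / 2 * ℓ)) := e2
    _ ≤ |C * 100 ^ d * M ^ d * L ^ (d + 2) * A₁ ^ 3| * ℓ ^ (r₀ * (d + 2 : ℕ) + p₁ * (3 : ℕ)) *
        Real.exp (-(1 / 2 * ℓ)) := bound_by_decay hℓ0.le (Real.exp_pos _).le le_rfl
    _ ≤ τ := hℓ₀ ℓ hℓ


/-- **p. 361 [7]** (render p007), the small terms of the quadratic form of (1.20): *"… can be bounded by
O(1)B₃⁵B₅M⁵A₁²p₁²(g_k)ε_k|𝐁₀| ≦ O(1)B₃⁵B₅M^{5+d}A₁²p₁²(g_k)R_k^{d+2}ε_k, and this bound is small for g_k small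
enough."* — PROVED for the right-hand side of `B16Sect1Statements.ineq120Q_arith` (its `O(1)` = `C·100^d`): with `ε_k
= g_kA₀p₀(g_k)` it is `≦ τ` for `0 < g_k ≦ g₀(τ, …)`. [cite: Balaban1989LargeFieldII, (1.20)–(1.21) p.361] -/
theorem ineq120Q_small (C B₃ B₅ M A₁ A₀ L p₀ p₁ r₀ : ℝ) (d : ℕ) (hC : 0 ≤ C) (hB₃ : 0 ≤ B₃) (hB₅ : 0 ≤ B₅)
    (hM : 0 ≤ M) (hA₀ : 0 ≤ A₀) {τ : ℝ} (hτ : 0 < τ) :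
    ∃ g₀ : ℝ, 0 < g₀ ∧ ∀ gk ℓ Rk p₀g p₁g εk : ℝ, 0 < gk → ℓ = Real.log (gk ^ 2)⁻¹ →
      ℓ ^ r₀ ≤ Rk → Rk ≤ L * ℓ ^ r₀ → gk ≤ g₀ → p₀g = ℓ ^ p₀ → p₁g = ℓ ^ p₁ →
      εk = gk * A₀ * p₀g →
      (C * 100 ^ d) * B₃ ^ 5 * B₅ * M ^ (5 + d) * A₁ ^ 2 * p₁g ^ 2 * Rk ^ (d + 2) * εk ≤ τ := by
  obtain ⟨ℓ₀, hℓ₀1, hℓ₀⟩ :=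
    decay_small (C * 100 ^ d * B₃ ^ 5 * B₅ * M ^ (5 + d) * A₁ ^ 2 * L ^ (d + 2) * A₀)
      (p₁ * (2 : ℕ) + r₀ * (d + 2 : ℕ) + p₀) (1 / 2) (by norm_num) hτ
  refine ⟨Real.exp (-(ℓ₀ / 2)), Real.exp_pos _, fun gk ℓ Rk p₀g p₁g εk hg0 hℓeq hRlo hRhi hg hp₀ hp₁ hε => ?_⟩
  have hℓ : ℓ₀ ≤ ℓ := by rw [hℓeq]; exact ell_ge_of_g_le hg0 hg
  have hℓ0 : 0 < ℓ := by linarith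
  have hRk : 0 ≤ Rk := le_trans (Real.rpow_nonneg hℓ0.le r₀) hRlo
  have hRpow : Rk ^ (d + 2) ≤ (L * ℓ ^ r₀) ^ (d + 2) := pow_le_pow_left₀ hRk hRhi _
  have hp0g : 0 ≤ p₀g := by rw [hp₀]; exact Real.rpow_nonneg hℓ0.le _
  have e2 : (C * 100 ^ d) * B₃ ^ 5 * B₅ * M ^ (5 + d) * A₁ ^ 2 * p₁g ^ 2 * (L * ℓ ^ r₀) ^ (d + 2) * εk =
      (C * 100 ^ d * B₃ ^ 5 * B₅ * M ^ (5 + d) * A₁ ^ 2 * L ^ (d + 2) * A₀) *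
        ℓ ^ (p₁ * (2 : ℕ) + r₀ * (d + 2 : ℕ) + p₀) * Real.exp (-(1 / 2 * ℓ)) := by
    rw [hε, hp₀, hp₁, mul_pow, Real.rpow_add hℓ0, Real.rpow_add hℓ0, ← rpow_pow_eq hℓ0.le, ← rpow_pow_eq hℓ0.le,
      g_eq_exp_of_ell hg0 hℓeq]
    ring_nf
  calc (C * 100 ^ d) * B₃ ^ 5 * B₅ * M ^ (5 + d) * A₁ ^ 2 * p₁g ^ 2 * Rk ^ (d + 2) * εk
      ≤ (C * 100 ^ d) * B₃ ^ 5 * B₅ * M ^ (5 + d) * A₁ ^ 2 * p₁g ^ 2 * (L * ℓ ^ r₀) ^ (d + 2) * εk := by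
        have hε0 : 0 ≤ εk := by rw [hε]; positivity
        exact mul_le_mul_of_nonneg_right (mul_le_mul_of_nonneg_left hRpow (by positivity)) hε0
    _ = (C * 100 ^ d * B₃ ^ 5 * B₅ * M ^ (5 + d) * A₁ ^ 2 * L ^ (d + 2) * A₀) *
        ℓ ^ (p₁ * (2 : ℕ) + r₀ * (d + 2 : ℕ) + p₀) * Real.exp (-(1 / 2 * ℓ)) := e2
    _ ≤ |C * 100 ^ d * B₃ ^ 5 * B₅ * M ^ (5 + d) * A₁ ^ 2 * L ^ (d + 2) * A₀| *
        ℓ ^ (p₁ * (2 : ℕ) + r₀ * (d + 2 : ℕ) + p₀) * Real.exp (-(1 / 2 * ℓ)) :=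
        bound_by_decay hℓ0.le (Real.exp_pos _).le le_rfl
    _ ≤ τ := hℓ₀ ℓ hℓ

/-! ## §3. p. 362: «the number multiplying g_k² can be made arbitrarily small» (rows B16.Txt@362, B16.Eq1.24) -/

/-- **p. 362 [8]** (render p008), after the bound on the second term of (1.24): *"≦ g_k²O(1)A₀²B₃²B₅M^{d+5}R_k^{d+1}
p₀²(g_k)exp(−R_k), and the number multiplying g_k² can be made arbitrarily small for g_k small enough."* — PROVED for
the right-hand side of `B16Sect1Statements.Ineq124snd` (constant `C'`): the number multiplying `g_k²` is `≦ τ` for `0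
< g_k ≦ g₀(τ, …)` (dictionary `p₀(g_k) = ℓ^{p₀}`, `ℓ^{r₀} ≦ R_k ≦ Lℓ^{r₀}`, `r₀ ≧ 1`: the polynomial growth
`R_k^{d+1}p₀²(g_k)` is killed by `exp(−R_k) ≦ exp(−ℓ)`). [cite: Balaban1989LargeFieldII, (1.24)–(1.25) p.362] -/
theorem ineq124snd_const_small (C' A₀ B₃ B₅ M L p₀ r₀ : ℝ) (d : ℕ) (hC : 0 ≤ C') (hB₅ : 0 ≤ B₅) (hM : 0 ≤ M)
    (hr₀ : 1 ≤ r₀) {τ : ℝ} (hτ : 0 < τ) :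
    ∃ g₀ : ℝ, 0 < g₀ ∧ ∀ gk ℓ Rk p₀g : ℝ, 0 < gk → ℓ = Real.log (gk ^ 2)⁻¹ →
      ℓ ^ r₀ ≤ Rk → Rk ≤ L * ℓ ^ r₀ → gk ≤ g₀ → p₀g = ℓ ^ p₀ →
      C' * A₀ ^ 2 * B₃ ^ 2 * B₅ * M ^ (d + 5) * Rk ^ (d + 1) * p₀g ^ 2 * Real.exp (-Rk) ≤ τ := by
  obtain ⟨ℓ₀, hℓ₀1, hℓ₀⟩ :=
    decay_small (C' * A₀ ^ 2 * B₃ ^ 2 * B₅ * M ^ (d + 5) * L ^ (d + 1)) (r₀ * (d + 1 : ℕ) + p₀ * (2 : ℕ)) 1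
      one_pos hτ
  refine ⟨Real.exp (-(ℓ₀ / 2)), Real.exp_pos _, fun gk ℓ Rk p₀g hg0 hℓeq hRlo hRhi hg hp₀ => ?_⟩
  have hℓ : ℓ₀ ≤ ℓ := by rw [hℓeq]; exact ell_ge_of_g_le hg0 hg
  have hℓ1 : 1 ≤ ℓ := le_trans hℓ₀1 hℓ
  have hℓ0 : 0 < ℓ := by linarith
  have hRk : 0 ≤ Rk := le_trans (Real.rpow_nonneg hℓ0.le r₀) hRlo
  have hR : ℓ ≤ Rk := le_trans (ell_le_rpow hℓ1 hr₀) hRlo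
  have hexp : Real.exp (-Rk) ≤ Real.exp (-(1 * ℓ)) := Real.exp_le_exp.mpr (by linarith)
  have hRpow : Rk ^ (d + 1) ≤ (L * ℓ ^ r₀) ^ (d + 1) := pow_le_pow_left₀ hRk hRhi _
  have hp0g : 0 ≤ p₀g := by rw [hp₀]; exact Real.rpow_nonneg hℓ0.le _
  have e2 : C' * A₀ ^ 2 * B₃ ^ 2 * B₅ * M ^ (d + 5) * (L * ℓ ^ r₀) ^ (d + 1) * p₀g ^ 2 * Real.exp (-Rk) =
      (C' * A₀ ^ 2 * B₃ ^ 2 * B₅ * M ^ (d + 5) * L ^ (d + 1)) * ℓ ^ (r₀ * (d + 1 : ℕ) + p₀ * (2 : ℕ)) *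
        Real.exp (-Rk) := by
    rw [hp₀, mul_pow, Real.rpow_add hℓ0, ← rpow_pow_eq hℓ0.le, ← rpow_pow_eq hℓ0.le]
    ring
  calc C' * A₀ ^ 2 * B₃ ^ 2 * B₅ * M ^ (d + 5) * Rk ^ (d + 1) * p₀g ^ 2 * Real.exp (-Rk)
      ≤ C' * A₀ ^ 2 * B₃ ^ 2 * B₅ * M ^ (d + 5) * (L * ℓ ^ r₀) ^ (d + 1) * p₀g ^ 2 * Real.exp (-Rk) := by
        refine mul_le_mul_of_nonneg_right (mul_le_mul_of_nonneg_right ?_ (by positivity)) (Real.exp_pos _).le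
        exact mul_le_mul_of_nonneg_left hRpow (by positivity)
    _ = (C' * A₀ ^ 2 * B₃ ^ 2 * B₅ * M ^ (d + 5) * L ^ (d + 1)) * ℓ ^ (r₀ * (d + 1 : ℕ) + p₀ * (2 : ℕ)) *
        Real.exp (-Rk) := e2
    _ ≤ |C' * A₀ ^ 2 * B₃ ^ 2 * B₅ * M ^ (d + 5) * L ^ (d + 1)| * ℓ ^ (r₀ * (d + 1 : ℕ) + p₀ * (2 : ℕ)) *
        Real.exp (-(1 * ℓ)) := bound_by_decay hℓ0.le (Real.exp_pos _).le hexp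
    _ ≤ τ := hℓ₀ ℓ hℓ


/-! ## §4. p. 363: the two boundary layers of (1.29) and the N-window (rows B16.Txt@363, B16.Lem@363, B16.Eq1.29) -/

/-- **p. 363 [9]** (render p009), the layer at `∂Ω_k`: *"… hence the whole expression can be bounded by
g_k(100MR_k)^{d−1}4dB₃A₀p₀(g_k)exp(−δ8MR_k)3(d − 1)ε_k, which is a small number, even after dividing by g_k²."* —
PROVED for the right-hand side of `B16Sect1Statements.Ineq129a`: divided by `g_k²` (with `ε_k = g_kA₀p₀(g_k)`) it is
`g_k`-free and `≦ τ` for `0 < g_k ≦ g₀(τ, …)`, the polynomial growth `R_k^{d−1}p₀²(g_k)` being killed by `exp(−8δMR_k) ≦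
exp(−8δMℓ)` (`δM > 0`, `R_k ≧ ℓ^{r₀} ≧ ℓ`). [cite: Balaban1989LargeFieldII, (1.29) p.363] -/
theorem ineq129a_small (M B₃ A₀ δ L p₀ r₀ : ℝ) (d : ℕ) (hd : 1 ≤ d) (hM : 0 < M) (hB₃ : 0 ≤ B₃) (hδ : 0 < δ)
    (hr₀ : 1 ≤ r₀) {τ : ℝ} (hτ : 0 < τ) :
    ∃ g₀ : ℝ, 0 < g₀ ∧ ∀ gk ℓ Rk p₀g εk : ℝ, 0 < gk → ℓ = Real.log (gk ^ 2)⁻¹ →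
      ℓ ^ r₀ ≤ Rk → Rk ≤ L * ℓ ^ r₀ → gk ≤ g₀ → p₀g = ℓ ^ p₀ → εk = gk * A₀ * p₀g →
      (gk ^ 2)⁻¹ * (gk * (100 * M * Rk) ^ (d - 1) * (4 * d * B₃ * A₀ * p₀g) * Real.exp (-(δ * 8 * M * Rk)) *
        (3 * ((d : ℝ) - 1) * εk)) ≤ τ := by
  have hc : 0 < 8 * δ * M := by positivity
  obtain ⟨ℓ₀, hℓ₀1, hℓ₀⟩ :=
    decay_small ((100 * M * L) ^ (d - 1) * (4 * d * B₃ * A₀) * (3 * ((d : ℝ) - 1) * A₀))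
      (r₀ * (d - 1 : ℕ) + p₀ * (2 : ℕ)) (8 * δ * M) hc hτ
  refine ⟨Real.exp (-(ℓ₀ / 2)), Real.exp_pos _, fun gk ℓ Rk p₀g εk hg0 hℓeq hRlo hRhi hg hp₀ hε => ?_⟩
  have hℓ : ℓ₀ ≤ ℓ := by rw [hℓeq]; exact ell_ge_of_g_le hg0 hg
  have hℓ1 : 1 ≤ ℓ := le_trans hℓ₀1 hℓ
  have hℓ0 : 0 < ℓ := by linarith
  have hRk : 0 ≤ Rk := le_trans (Real.rpow_nonneg hℓ0.le r₀) hRlo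
  have hR : ℓ ≤ Rk := le_trans (ell_le_rpow hℓ1 hr₀) hRlo
  have hd1 : (0 : ℝ) ≤ (d : ℝ) - 1 := by
    have : (1 : ℝ) ≤ d := by exact_mod_cast hd
    linarith
  have hp0g : 0 ≤ p₀g := by rw [hp₀]; exact Real.rpow_nonneg hℓ0.le _
  have hexp : Real.exp (-(δ * 8 * M * Rk)) ≤ Real.exp (-(8 * δ * M * ℓ)) := by
    apply Real.exp_le_exp.mpr
    have : 8 * δ * M * ℓ ≤ 8 * δ * M * Rk := mul_le_mul_of_nonneg_left hR hc.le
    linarith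
  have hRpow : (100 * M * Rk) ^ (d - 1) ≤ (100 * M * (L * ℓ ^ r₀)) ^ (d - 1) :=
    pow_le_pow_left₀ (by positivity) (mul_le_mul_of_nonneg_left hRhi (by positivity)) _
  have e1 : (gk ^ 2)⁻¹ * (gk * (100 * M * Rk) ^ (d - 1) * (4 * d * B₃ * A₀ * p₀g) *
      Real.exp (-(δ * 8 * M * Rk)) * (3 * ((d : ℝ) - 1) * εk)) =
      (4 * d * B₃ * A₀ * p₀g) * (3 * ((d : ℝ) - 1) * A₀ * p₀g) * (100 * M * Rk) ^ (d - 1) *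
        Real.exp (-(δ * 8 * M * Rk)) := by
    rw [hε]; field_simp
  have e2 : (4 * d * B₃ * A₀ * p₀g) * (3 * ((d : ℝ) - 1) * A₀ * p₀g) * (100 * M * (L * ℓ ^ r₀)) ^ (d - 1) *
      Real.exp (-(δ * 8 * M * Rk)) =
      ((100 * M * L) ^ (d - 1) * (4 * d * B₃ * A₀) * (3 * ((d : ℝ) - 1) * A₀)) *
        ℓ ^ (r₀ * (d - 1 : ℕ) + p₀ * (2 : ℕ)) * Real.exp (-(δ * 8 * M * Rk)) := by
    rw [hp₀, show (100 : ℝ) * M * (L * ℓ ^ r₀) = (100 * M * L) * ℓ ^ r₀ by ring, mul_pow, Real.rpow_add hℓ0,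
      ← rpow_pow_eq hℓ0.le, ← rpow_pow_eq hℓ0.le]
    ring
  calc (gk ^ 2)⁻¹ * (gk * (100 * M * Rk) ^ (d - 1) * (4 * d * B₃ * A₀ * p₀g) * Real.exp (-(δ * 8 * M * Rk)) *
        (3 * ((d : ℝ) - 1) * εk))
      = (4 * d * B₃ * A₀ * p₀g) * (3 * ((d : ℝ) - 1) * A₀ * p₀g) * (100 * M * Rk) ^ (d - 1) *
        Real.exp (-(δ * 8 * M * Rk)) := e1
    _ ≤ (4 * d * B₃ * A₀ * p₀g) * (3 * ((d : ℝ) - 1) * A₀ * p₀g) * (100 * M * (L * ℓ ^ r₀)) ^ (d - 1) *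
        Real.exp (-(δ * 8 * M * Rk)) := by
        refine mul_le_mul_of_nonneg_right (mul_le_mul_of_nonneg_left hRpow ?_) (Real.exp_pos _).le
        have : 0 ≤ (4 * d * B₃ * A₀ * p₀g) * (3 * ((d : ℝ) - 1) * A₀ * p₀g) := by
          have h' : (4 * d * B₃ * A₀ * p₀g) * (3 * ((d : ℝ) - 1) * A₀ * p₀g) =
              12 * d * ((d : ℝ) - 1) * B₃ * (A₀ * p₀g) ^ 2 := by ring
          rw [h']; positivity
        exact this
    _ = ((100 * M * L) ^ (d - 1) * (4 * d * B₃ * A₀) * (3 * ((d : ℝ) - 1) * A₀)) *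
        ℓ ^ (r₀ * (d - 1 : ℕ) + p₀ * (2 : ℕ)) * Real.exp (-(δ * 8 * M * Rk)) := e2
    _ ≤ |(100 * M * L) ^ (d - 1) * (4 * d * B₃ * A₀) * (3 * ((d : ℝ) - 1) * A₀)| *
        ℓ ^ (r₀ * (d - 1 : ℕ) + p₀ * (2 : ℕ)) * Real.exp (-(8 * δ * M * ℓ)) :=
        bound_by_decay hℓ0.le (Real.exp_pos _).le hexp
    _ ≤ τ := hℓ₀ ℓ hℓ

/-- **The N-window mechanism** behind p. 363 *"small if L^{−N} is small enough"* and p. 364 *"For N satisfying the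
conditions discussed above the bound … is small"*: for any natural `m`, under the lower window `L^{−N} ≦ ℓ^{−ν}`
(`B16Sect1Kernels.NWindowLower`), the upper window `N ≦ R_k` (`B16Sect1Kernels.NWindowUpper`) and the dictionary `R_k ≦
Lℓ^{r₀}`, `p₀(g_k) = ℓ^{p₀}`, one has `L^{−mN}·N^{mβ₀}·R_k^m·p₀²(g_k) ≦ L^{(1+β₀)m}·ℓ^{2p₀ + (1+β₀)r₀m − νm}`. PROVED
(`Linv` = `L⁻¹` as in the siblings). [cite: Balaban1989LargeFieldII, p.363 (after (1.29))] -/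
theorem window_core {L Linv ℓ ν β₀ r₀ p₀ Rk p₀g : ℝ} {N : ℕ} (m : ℕ) (hL : 1 ≤ L) (hLinv : Linv = L⁻¹)
    (hℓ : 1 ≤ ℓ) (hlow : B16Sect1Kernels.NWindowLower L N ℓ ν) (hup : B16Sect1Kernels.NWindowUpper N Rk)
    (hβ₀ : 0 ≤ β₀) (hRhi : Rk ≤ L * ℓ ^ r₀) (hp₀g : p₀g = ℓ ^ p₀) :
    Linv ^ (m * N) * ((N : ℝ) ^ β₀) ^ m * Rk ^ m * p₀g ^ 2 ≤
      L ^ ((1 + β₀) * m) * ℓ ^ (p₀ * 2 + (1 + β₀) * r₀ * m - ν * m) := by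
  have hL0 : 0 < L := by linarith
  have hℓ0 : 0 < ℓ := by linarith
  have hN0 : (0 : ℝ) ≤ N := Nat.cast_nonneg N
  have hup' : (N : ℝ) ≤ Rk := hup
  have hRk : 0 ≤ Rk := le_trans hN0 hup'
  have hlow' : L ^ (-(N : ℝ)) ≤ ℓ ^ (-ν) := hlow
  have f1 : Linv ^ (m * N) ≤ (ℓ ^ (-ν)) ^ m := by
    have e : Linv ^ (m * N) = (L ^ (-(N : ℝ))) ^ m := by
      rw [mul_comm m N, pow_mul, hLinv, inv_pow, Real.rpow_neg hL0.le, Real.rpow_natCast]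
    rw [e]; exact pow_le_pow_left₀ (Real.rpow_nonneg hL0.le _) hlow' m
  have f2 : ((N : ℝ) ^ β₀) ^ m ≤ (L ^ β₀ * ℓ ^ (r₀ * β₀)) ^ m := by
    refine pow_le_pow_left₀ (Real.rpow_nonneg hN0 _) ?_ m
    calc (N : ℝ) ^ β₀ ≤ Rk ^ β₀ := Real.rpow_le_rpow hN0 hup' hβ₀
      _ ≤ (L * ℓ ^ r₀) ^ β₀ := Real.rpow_le_rpow hRk hRhi hβ₀
      _ = L ^ β₀ * ℓ ^ (r₀ * β₀) := by
          rw [Real.mul_rpow hL0.le (Real.rpow_nonneg hℓ0.le _), Real.rpow_mul hℓ0.le]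
  have f3 : Rk ^ m ≤ (L * ℓ ^ r₀) ^ m := pow_le_pow_left₀ hRk hRhi m
  have hLinv0 : 0 ≤ Linv := by rw [hLinv]; positivity
  calc Linv ^ (m * N) * ((N : ℝ) ^ β₀) ^ m * Rk ^ m * p₀g ^ 2
      ≤ (ℓ ^ (-ν)) ^ m * (L ^ β₀ * ℓ ^ (r₀ * β₀)) ^ m * (L * ℓ ^ r₀) ^ m * (ℓ ^ p₀) ^ 2 := by
        rw [hp₀g]
        refine mul_le_mul_of_nonneg_right ?_ (by positivity)
        exact mul_le_mul (mul_le_mul f1 f2 (by positivity) (by positivity)) f3 (by positivity) (by positivity)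
    _ = L ^ ((1 + β₀) * m) * ℓ ^ (p₀ * 2 + (1 + β₀) * r₀ * m - ν * m) := by
        rw [mul_pow, mul_pow, rpow_pow_eq hℓ0.le, rpow_pow_eq hℓ0.le, rpow_pow_eq hℓ0.le, rpow_pow_eq hℓ0.le,
          rpow_pow_eq hL0.le, ← Real.rpow_natCast L m]
        have eL : L ^ ((1 + β₀) * (m : ℝ)) = L ^ (β₀ * m) * L ^ (m : ℝ) := by
          rw [← Real.rpow_add hL0]; congr 1; ring
        have eℓ : ℓ ^ (p₀ * 2 + (1 + β₀) * r₀ * m - ν * m) =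
            ℓ ^ (-ν * m) * ℓ ^ (r₀ * β₀ * m) * ℓ ^ (r₀ * m) * ℓ ^ (p₀ * (2 : ℕ)) := by
          rw [← Real.rpow_add hℓ0, ← Real.rpow_add hℓ0, ← Real.rpow_add hℓ0]; congr 1; push_cast; ring
        rw [eL, eℓ]; ring

/-- **p. 363 [9], what «ν ≧ 2p₀ + dr₀» buys for the layer at `∂Ω″_{h+1}`** (render p009), verbatim: *"≦ g_k²
L^{−(d−1)N}N^{(d−1)β₀}O(1)A₀²B₃²B₅M^{d+5}R_k^{d−1}p₀²(g_k). The number multiplying g_k² is small if L^{−N} is small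
enough, for example if L^{−N} ≦ (log g_k⁻²)^{−ν} for sufficiently large ν, or N ≧ (ν/log L)log log g_k⁻². For the
smallness of the above bound we need ν ≧ 2p₀ + dr₀."* — PROVED: under `NWindowLower`, `NuCondition363 ν p₀ r₀ d`,
`NWindowUpper` and the dictionary, the `g_k`-dependent part `L^{−(d−1)N}N^{(d−1)β₀}R_k^{d−1}p₀²(g_k)` of that number
(`Nb` = `N^{β₀}` as in `B16Sect1Statements.ineq129b_arith`) is at most `L^{(1+β₀)(d−1)}·ℓ^{−κ}` with the explicit
`κ = 2p₀(d−2) + r₀(d−1)(d−1−β₀)` (`d ≥ 2`). [cite: Balaban1989LargeFieldII, p.363 (after (1.29))] -/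
theorem window363 {L Linv ℓ ν β₀ r₀ p₀ Rk p₀g Nb : ℝ} {N d : ℕ} (hd : 2 ≤ d) (hL : 1 ≤ L) (hLinv : Linv = L⁻¹)
    (hℓ : 1 ≤ ℓ) (hlow : B16Sect1Kernels.NWindowLower L N ℓ ν) (hν : B16Sect1Kernels.NuCondition363 ν p₀ r₀ d)
    (hup : B16Sect1Kernels.NWindowUpper N Rk) (hβ₀ : 0 ≤ β₀) (hRhi : Rk ≤ L * ℓ ^ r₀) (hp₀g : p₀g = ℓ ^ p₀)
    (hNb : Nb = (N : ℝ) ^ β₀) :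
    Linv ^ ((d - 1) * N) * Nb ^ (d - 1) * Rk ^ (d - 1) * p₀g ^ 2 ≤
      L ^ ((1 + β₀) * (d - 1 : ℕ)) *
        ℓ ^ (-(2 * p₀ * ((d : ℝ) - 2) + r₀ * ((d : ℝ) - 1) * ((d : ℝ) - 1 - β₀))) := by
  have h := window_core (d - 1) hL hLinv hℓ hlow hup hβ₀ hRhi hp₀g
  rw [hNb]
  refine h.trans (mul_le_mul_of_nonneg_left (rpow_le_rpow_of_le hℓ ?_) (by positivity))
  unfold B16Sect1Kernels.NuCondition363 at hν
  have hd1 : ((d - 1 : ℕ) : ℝ) = (d : ℝ) - 1 := by rw [Nat.cast_sub (by omega), Nat.cast_one]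
  rw [hd1]
  have hd2 : (2 : ℝ) ≤ d := by exact_mod_cast hd
  have key : (2 * p₀ + d * r₀) * ((d : ℝ) - 1) ≤ ν * ((d : ℝ) - 1) :=
    mul_le_mul_of_nonneg_right hν (by linarith)
  nlinarith [key]

/-- Consequently (`ℓ ≧ 1`, `κ ≧ 0` for `p₀, r₀ ≧ 0`, `β₀ ≦ 1`, `d ≧ 2`): the `g_k`-dependent part is at most the
`g_k`-INDEPENDENT constant `L^{(1+β₀)(d−1)}` — the number multiplying `g_k²` on p. 363 is bounded uniformly in `g_k`.
[cite: Balaban1989LargeFieldII, p.363 (after (1.29))] -/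
theorem window363_le_const {L Linv ℓ ν β₀ r₀ p₀ Rk p₀g Nb : ℝ} {N d : ℕ} (hd : 2 ≤ d) (hL : 1 ≤ L)
    (hLinv : Linv = L⁻¹) (hℓ : 1 ≤ ℓ) (hlow : B16Sect1Kernels.NWindowLower L N ℓ ν)
    (hν : B16Sect1Kernels.NuCondition363 ν p₀ r₀ d) (hup : B16Sect1Kernels.NWindowUpper N Rk) (hβ₀ : 0 ≤ β₀)
    (hβ₁ : β₀ ≤ 1) (hp₀ : 0 ≤ p₀) (hr₀ : 0 ≤ r₀) (hRhi : Rk ≤ L * ℓ ^ r₀) (hp₀g : p₀g = ℓ ^ p₀)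
    (hNb : Nb = (N : ℝ) ^ β₀) :
    Linv ^ ((d - 1) * N) * Nb ^ (d - 1) * Rk ^ (d - 1) * p₀g ^ 2 ≤ L ^ ((1 + β₀) * (d - 1 : ℕ)) := by
  refine (window363 hd hL hLinv hℓ hlow hν hup hβ₀ hRhi hp₀g hNb).trans ?_
  have hL0 : 0 < L := by linarith
  have hd2 : (2 : ℝ) ≤ d := by exact_mod_cast hd
  have hκ : 0 ≤ 2 * p₀ * ((d : ℝ) - 2) + r₀ * ((d : ℝ) - 1) * ((d : ℝ) - 1 - β₀) := by
    have h1 : 0 ≤ 2 * p₀ * ((d : ℝ) - 2) := by nlinarith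
    have h2 : 0 ≤ r₀ * ((d : ℝ) - 1) * ((d : ℝ) - 1 - β₀) := by
      have : 0 ≤ ((d : ℝ) - 1) * ((d : ℝ) - 1 - β₀) := by nlinarith
      nlinarith
    linarith
  have hone : ℓ ^ (-(2 * p₀ * ((d : ℝ) - 2) + r₀ * ((d : ℝ) - 1) * ((d : ℝ) - 1 - β₀))) ≤ 1 :=
    Real.rpow_le_one_of_one_le_of_nonpos hℓ (by linarith)
  calc L ^ ((1 + β₀) * (d - 1 : ℕ)) * ℓ ^ (-(2 * p₀ * ((d : ℝ) - 2) + r₀ * ((d : ℝ) - 1) * ((d : ℝ) - 1 - β₀)))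
      ≤ L ^ ((1 + β₀) * (d - 1 : ℕ)) * 1 := mul_le_mul_of_nonneg_left hone (by positivity)
    _ = _ := mul_one _

/-- **The whole p. 363 sentence for the second layer**, PROVED: the number multiplying `g_k²` in the right-hand side of
`B16Sect1Statements.ineq129b_arith` (its `O(1)` = `4d(d−1)100^{d−1}C₃^{d−1}C`) is at most
`O(1)A₀²B₃²B₅M^{d+5}·L^{(1+β₀)(d−1)}·ℓ^{−κ}`, `κ = 2p₀(d−2) + r₀(d−1)(d−1−β₀) ≧ 0` — uniformly bounded in `g_k` and, for
`κ > 0` (e.g. the printed `d = 4`), tending to `0` with `g_k` (`rpow_neg_small`). [cite: Balaban1989LargeFieldII, (1.29) p.363] -/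
theorem ineq129b_window {L Linv ℓ ν β₀ r₀ p₀ Rk p₀g Nb C₃ C A₀ B₃ B₅ M : ℝ} {N d : ℕ} (hd : 2 ≤ d)
    (hL : 1 ≤ L) (hLinv : Linv = L⁻¹) (hℓ : 1 ≤ ℓ) (hlow : B16Sect1Kernels.NWindowLower L N ℓ ν)
    (hν : B16Sect1Kernels.NuCondition363 ν p₀ r₀ d) (hup : B16Sect1Kernels.NWindowUpper N Rk) (hβ₀ : 0 ≤ β₀)
    (hRhi : Rk ≤ L * ℓ ^ r₀) (hp₀g : p₀g = ℓ ^ p₀) (hNb : Nb = (N : ℝ) ^ β₀) (hC₃ : 0 ≤ C₃) (hC : 0 ≤ C)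
    (hB₅ : 0 ≤ B₅) (hM : 0 ≤ M) :
    Linv ^ ((d - 1) * N) * Nb ^ (d - 1) *
        (4 * d * ((d : ℝ) - 1) * 100 ^ (d - 1) * C₃ ^ (d - 1) * C) *
        A₀ ^ 2 * B₃ ^ 2 * B₅ * M ^ (d + 5) * Rk ^ (d - 1) * p₀g ^ 2 ≤
      (4 * d * ((d : ℝ) - 1) * 100 ^ (d - 1) * C₃ ^ (d - 1) * C) * A₀ ^ 2 * B₃ ^ 2 * B₅ * M ^ (d + 5) *
        (L ^ ((1 + β₀) * (d - 1 : ℕ)) *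
          ℓ ^ (-(2 * p₀ * ((d : ℝ) - 2) + r₀ * ((d : ℝ) - 1) * ((d : ℝ) - 1 - β₀)))) := by
  have h := window363 hd hL hLinv hℓ hlow hν hup hβ₀ hRhi hp₀g hNb
  have hd1 : (0 : ℝ) ≤ (d : ℝ) - 1 := by
    have : (2 : ℝ) ≤ d := by exact_mod_cast hd
    linarith
  have hK : 0 ≤ (4 * d * ((d : ℝ) - 1) * 100 ^ (d - 1) * C₃ ^ (d - 1) * C) * A₀ ^ 2 * B₃ ^ 2 * B₅ *
      M ^ (d + 5) := by positivity
  calc Linv ^ ((d - 1) * N) * Nb ^ (d - 1) *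
        (4 * d * ((d : ℝ) - 1) * 100 ^ (d - 1) * C₃ ^ (d - 1) * C) *
        A₀ ^ 2 * B₃ ^ 2 * B₅ * M ^ (d + 5) * Rk ^ (d - 1) * p₀g ^ 2
      = (4 * d * ((d : ℝ) - 1) * 100 ^ (d - 1) * C₃ ^ (d - 1) * C) * A₀ ^ 2 * B₃ ^ 2 * B₅ * M ^ (d + 5) *
        (Linv ^ ((d - 1) * N) * Nb ^ (d - 1) * Rk ^ (d - 1) * p₀g ^ 2) := by ring
    _ ≤ _ := mul_le_mul_of_nonneg_left h hK


/-! ## §5. p. 364: the (1.31) number under the same window (row B16.Eq1.31) -/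

/-- **p. 364 [10]** (render p010), verbatim: *"0 ≦ A(ζ₁, U₀) < g_k²L^{−4N}N^{4β₀}O(1)A₀²B₃²B₅²M^{14}R_k⁴p₀²(g_k). (1.31)
For N satisfying the conditions discussed above the bound on the right-hand side above is small, after dividing by
g_k²."* — PROVED: under the N-window with the printed `ν ≧ 2p₀ + dr₀` at `d = 4` (`NuCondition363 ν p₀ r₀ 4`), the
`g_k`-dependent part `L^{−4N}N^{4β₀}R_k⁴p₀²(g_k)` of the right-hand side of `B16Sect1Wilson.Ineq131` is at most
`L^{4(1+β₀)}·ℓ^{−(6p₀ + (12 − 4β₀)r₀)}`. [cite: Balaban1989LargeFieldII, (1.31) p.364] -/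
theorem window364 {L Linv ℓ ν β₀ r₀ p₀ Rk p₀g : ℝ} {N : ℕ} (hL : 1 ≤ L) (hLinv : Linv = L⁻¹) (hℓ : 1 ≤ ℓ)
    (hlow : B16Sect1Kernels.NWindowLower L N ℓ ν) (hν : B16Sect1Kernels.NuCondition363 ν p₀ r₀ 4)
    (hup : B16Sect1Kernels.NWindowUpper N Rk) (hβ₀ : 0 ≤ β₀) (hRhi : Rk ≤ L * ℓ ^ r₀) (hp₀g : p₀g = ℓ ^ p₀) :
    Linv ^ (4 * N) * (N : ℝ) ^ (4 * β₀) * Rk ^ 4 * p₀g ^ 2 ≤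
      L ^ ((1 + β₀) * (4 : ℕ)) * ℓ ^ (-(6 * p₀ + (12 - 4 * β₀) * r₀)) := by
  have hN0 : (0 : ℝ) ≤ N := Nat.cast_nonneg N
  have e : (N : ℝ) ^ (4 * β₀) = ((N : ℝ) ^ β₀) ^ 4 := by
    rw [rpow_pow_eq hN0]; congr 1; push_cast; ring
  have h := window_core 4 hL hLinv hℓ hlow hup hβ₀ hRhi hp₀g
  rw [e]
  refine h.trans (mul_le_mul_of_nonneg_left (rpow_le_rpow_of_le hℓ ?_) (by positivity))
  unfold B16Sect1Kernels.NuCondition363 at hν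
  push_cast at hν ⊢
  nlinarith [hν, hβ₀]

/-- Hence **(1.31) divided by `g_k²`**: from `B16Sect1Wilson.Ineq131` (as typed by the first module of the block) and
the window, `A(ζ₁,U₀)/g_k² < O(1)A₀²B₃²B₅²M^{14}·L^{4(1+β₀)}·ℓ^{−(6p₀ + (12−4β₀)r₀)}` — bounded uniformly in `g_k`, and
tending to `0` with `g_k` as soon as `p₀ > 0` or `r₀ > 0` (the exponent is then negative; `rpow_neg_small`). PROVED.
[cite: Balaban1989LargeFieldII, (1.31) p.364] -/
theorem ineq131_window {A gk L Linv ℓ ν β₀ r₀ p₀ Rk p₀g C A₀ B₃ B₅ M : ℝ} {N : ℕ} (hL : 1 ≤ L)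
    (hLinv : Linv = L⁻¹) (hℓ : 1 ≤ ℓ) (hlow : B16Sect1Kernels.NWindowLower L N ℓ ν)
    (hν : B16Sect1Kernels.NuCondition363 ν p₀ r₀ 4) (hup : B16Sect1Kernels.NWindowUpper N Rk) (hβ₀ : 0 ≤ β₀)
    (hRhi : Rk ≤ L * ℓ ^ r₀) (hp₀g : p₀g = ℓ ^ p₀) (hC : 0 ≤ C) (hgk : 0 < gk)
    (h131 : B16Sect1Wilson.Ineq131 A gk Linv N β₀ C A₀ B₃ B₅ M Rk p₀g) :
    (gk ^ 2)⁻¹ * A ≤ C * A₀ ^ 2 * B₃ ^ 2 * B₅ ^ 2 * M ^ 14 *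
      (L ^ ((1 + β₀) * (4 : ℕ)) * ℓ ^ (-(6 * p₀ + (12 - 4 * β₀) * r₀))) := by
  obtain ⟨-, hA⟩ := h131
  have hw := window364 hL hLinv hℓ hlow hν hup hβ₀ hRhi hp₀g
  have hK : 0 ≤ C * A₀ ^ 2 * B₃ ^ 2 * B₅ ^ 2 * M ^ 14 := by positivity
  have hg2 : 0 < gk ^ 2 := by positivity
  rw [inv_mul_le_iff₀ hg2]
  calc A ≤ gk ^ 2 * Linv ^ (4 * N) * (N : ℝ) ^ (4 * β₀) * C * A₀ ^ 2 * B₃ ^ 2 * B₅ ^ 2 * M ^ 14 * Rk ^ 4 *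
        p₀g ^ 2 := hA.le
    _ = gk ^ 2 * ((C * A₀ ^ 2 * B₃ ^ 2 * B₅ ^ 2 * M ^ 14) *
        (Linv ^ (4 * N) * (N : ℝ) ^ (4 * β₀) * Rk ^ 4 * p₀g ^ 2)) := by ring
    _ ≤ gk ^ 2 * ((C * A₀ ^ 2 * B₃ ^ 2 * B₅ ^ 2 * M ^ 14) *
        (L ^ ((1 + β₀) * (4 : ℕ)) * ℓ ^ (-(6 * p₀ + (12 - 4 * β₀) * r₀)))) :=
        mul_le_mul_of_nonneg_left (mul_le_mul_of_nonneg_left hw hK) hg2.le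

/-! ## §6. p. 366: the second term of (1.37) tends to zero with `g_k` (row B16.Lem@366) -/

/-- **p. 366 [12]** (render p012), verbatim: *"… so it can be bounded by O(1)N^{2+4β₀}(100MR_k)⁴(O(1)B₃B₅M⁵ε_k +
O(1)B₃δ′_k)² ≦ O(1)B₃²B₅²M⁹R_k⁷ε_k², and the bound is small for g_k small enough."* — PROVED directly for the MIDDLE
expression (the right-hand side of `B16Sect1Statements.Ineq366`, constants `C, C', C''`): with `N ≦ R_k`, `ε_k =
g_kA₀p₀(g_k)`, `δ′_k = g_kA₁p₁(g_k)` and the dictionary it is `≦ τ` for `0 < g_k ≦ g₀(τ, …)` (so the printed final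
form, whose power of `M` the cell records as a slip D-b02.3, is not needed for the smallness the text uses). [cite: Balaban1989LargeFieldII, p.366 (after (1.37))] -/
theorem ineq366_mid_small (C C' C'' B₃ B₅ M A₀ A₁ L β₀ p₀ p₁ r₀ : ℝ) (hC : 0 ≤ C) (hC' : 0 ≤ C') (hC'' : 0 ≤ C'')
    (hB₃ : 0 ≤ B₃) (hB₅ : 0 ≤ B₅) (hM : 0 ≤ M) (hA₀ : 0 ≤ A₀) (hA₁ : 0 ≤ A₁) (hL : 0 ≤ L) (hβ₀ : 0 ≤ β₀)
    (hp₀ : 0 ≤ p₀) (hp₁ : 0 ≤ p₁) {τ : ℝ} (hτ : 0 < τ) :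
    ∃ g₀ : ℝ, 0 < g₀ ∧ ∀ (gk ℓ Rk p₀g p₁g εk δ'k : ℝ) (N : ℕ), 0 < gk → ℓ = Real.log (gk ^ 2)⁻¹ →
      ℓ ^ r₀ ≤ Rk → Rk ≤ L * ℓ ^ r₀ → gk ≤ g₀ → p₀g = ℓ ^ p₀ →
      p₁g = ℓ ^ p₁ → εk = gk * A₀ * p₀g → δ'k = gk * A₁ * p₁g → B16Sect1Kernels.NWindowUpper N Rk →
      C * (N : ℝ) ^ (2 + 4 * β₀) * (100 * M * Rk) ^ 4 * (C' * B₃ * B₅ * M ^ 5 * εk + C'' * B₃ * δ'k) ^ 2 ≤ τ := by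
  set s₀ : ℝ := C' * B₃ * B₅ * M ^ 5 * A₀ + C'' * B₃ * A₁ with hs₀
  have hs₀0 : 0 ≤ s₀ := by rw [hs₀]; positivity
  obtain ⟨ℓ₀, hℓ₀1, hℓ₀⟩ :=
    decay_small (C * L ^ (2 + 4 * β₀) * (100 * M * L) ^ 4 * s₀ ^ 2)
      (r₀ * (2 + 4 * β₀) + r₀ * (4 : ℕ) + (p₀ + p₁) * (2 : ℕ)) 1 one_pos hτ
  refine ⟨Real.exp (-(ℓ₀ / 2)), Real.exp_pos _,
    fun gk ℓ Rk p₀g p₁g εk δ'k N hg0 hℓeq hRlo hRhi hg hp₀g hp₁g hε hδ hup => ?_⟩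
  have hℓ : ℓ₀ ≤ ℓ := by rw [hℓeq]; exact ell_ge_of_g_le hg0 hg
  have hℓ1 : 1 ≤ ℓ := le_trans hℓ₀1 hℓ
  have hℓ0 : 0 < ℓ := by linarith
  have hRk : 0 ≤ Rk := le_trans (Real.rpow_nonneg hℓ0.le r₀) hRlo
  have hN0 : (0 : ℝ) ≤ N := Nat.cast_nonneg N
  have hup' : (N : ℝ) ≤ Rk := hup
  have h24 : 0 ≤ 2 + 4 * β₀ := by linarith
  -- the three factors
  have f1 : (N : ℝ) ^ (2 + 4 * β₀) ≤ L ^ (2 + 4 * β₀) * ℓ ^ (r₀ * (2 + 4 * β₀)) := by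
    calc (N : ℝ) ^ (2 + 4 * β₀) ≤ Rk ^ (2 + 4 * β₀) := Real.rpow_le_rpow hN0 hup' h24
      _ ≤ (L * ℓ ^ r₀) ^ (2 + 4 * β₀) := Real.rpow_le_rpow hRk hRhi h24
      _ = L ^ (2 + 4 * β₀) * ℓ ^ (r₀ * (2 + 4 * β₀)) := by
          rw [Real.mul_rpow hL (Real.rpow_nonneg hℓ0.le _), Real.rpow_mul hℓ0.le]
  have f2 : (100 * M * Rk) ^ 4 ≤ (100 * M * L) ^ 4 * ℓ ^ (r₀ * (4 : ℕ)) := by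
    calc (100 * M * Rk) ^ 4 ≤ (100 * M * (L * ℓ ^ r₀)) ^ 4 :=
          pow_le_pow_left₀ (by positivity) (mul_le_mul_of_nonneg_left hRhi (by positivity)) 4
      _ = (100 * M * L) ^ 4 * ℓ ^ (r₀ * (4 : ℕ)) := by
          rw [show (100 : ℝ) * M * (L * ℓ ^ r₀) = (100 * M * L) * ℓ ^ r₀ by ring, mul_pow, rpow_pow_eq hℓ0.le]
  have hsum : C' * B₃ * B₅ * M ^ 5 * εk + C'' * B₃ * δ'k = gk * (C' * B₃ * B₅ * M ^ 5 * A₀ * ℓ ^ p₀ +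
      C'' * B₃ * A₁ * ℓ ^ p₁) := by
    rw [hε, hδ, hp₀g, hp₁g]; ring
  have hS : C' * B₃ * B₅ * M ^ 5 * A₀ * ℓ ^ p₀ + C'' * B₃ * A₁ * ℓ ^ p₁ ≤ s₀ * ℓ ^ (p₀ + p₁) := by
    have h1 : ℓ ^ p₀ ≤ ℓ ^ (p₀ + p₁) := rpow_le_rpow_of_le hℓ1 (by linarith)
    have h2 : ℓ ^ p₁ ≤ ℓ ^ (p₀ + p₁) := rpow_le_rpow_of_le hℓ1 (by linarith)
    rw [hs₀]
    have ha : 0 ≤ C' * B₃ * B₅ * M ^ 5 * A₀ := by positivity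
    have hb : 0 ≤ C'' * B₃ * A₁ := by positivity
    nlinarith [mul_le_mul_of_nonneg_left h1 ha, mul_le_mul_of_nonneg_left h2 hb]
  have hS0 : 0 ≤ C' * B₃ * B₅ * M ^ 5 * A₀ * ℓ ^ p₀ + C'' * B₃ * A₁ * ℓ ^ p₁ := by positivity
  have f3 : (C' * B₃ * B₅ * M ^ 5 * εk + C'' * B₃ * δ'k) ^ 2 ≤ (s₀ ^ 2 * ℓ ^ ((p₀ + p₁) * (2 : ℕ))) *
      Real.exp (-(1 * ℓ)) := by
    rw [hsum, mul_pow, gsq_eq_exp_of_ell hg0 hℓeq, ← rpow_pow_eq hℓ0.le, ← mul_pow]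
    have : (C' * B₃ * B₅ * M ^ 5 * A₀ * ℓ ^ p₀ + C'' * B₃ * A₁ * ℓ ^ p₁) ^ 2 ≤ (s₀ * ℓ ^ (p₀ + p₁)) ^ 2 :=
      pow_le_pow_left₀ hS0 hS 2
    calc Real.exp (-ℓ) * (C' * B₃ * B₅ * M ^ 5 * A₀ * ℓ ^ p₀ + C'' * B₃ * A₁ * ℓ ^ p₁) ^ 2
        ≤ Real.exp (-ℓ) * (s₀ * ℓ ^ (p₀ + p₁)) ^ 2 := mul_le_mul_of_nonneg_left this (Real.exp_pos _).le
      _ = (s₀ * ℓ ^ (p₀ + p₁)) ^ 2 * Real.exp (-(1 * ℓ)) := by ring_nf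
  calc C * (N : ℝ) ^ (2 + 4 * β₀) * (100 * M * Rk) ^ 4 * (C' * B₃ * B₅ * M ^ 5 * εk + C'' * B₃ * δ'k) ^ 2
      ≤ C * (L ^ (2 + 4 * β₀) * ℓ ^ (r₀ * (2 + 4 * β₀))) * ((100 * M * L) ^ 4 * ℓ ^ (r₀ * (4 : ℕ))) *
          ((s₀ ^ 2 * ℓ ^ ((p₀ + p₁) * (2 : ℕ))) * Real.exp (-(1 * ℓ))) := by
        refine mul_le_mul (mul_le_mul (mul_le_mul_of_nonneg_left f1 hC) f2 (by positivity) (by positivity)) f3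
          (by positivity) (by positivity)
    _ = (C * L ^ (2 + 4 * β₀) * (100 * M * L) ^ 4 * s₀ ^ 2) *
          ℓ ^ (r₀ * (2 + 4 * β₀) + r₀ * (4 : ℕ) + (p₀ + p₁) * (2 : ℕ)) * Real.exp (-(1 * ℓ)) := by
        rw [Real.rpow_add hℓ0, Real.rpow_add hℓ0]; ring
    _ ≤ |C * L ^ (2 + 4 * β₀) * (100 * M * L) ^ 4 * s₀ ^ 2| *
          ℓ ^ (r₀ * (2 + 4 * β₀) + r₀ * (4 : ℕ) + (p₀ + p₁) * (2 : ℕ)) * Real.exp (-(1 * ℓ)) :=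
        bound_by_decay hℓ0.le (Real.exp_pos _).le le_rfl
    _ ≤ τ := hℓ₀ ℓ hℓ


/-! ## §7. p. 368: the last clause of (1.47) with the condition on `N` made explicit (row B16.Eq1.47) -/

/-- **p. 368 [14]** (render p014), after (1.47): *"≦ O(1)A₀C₁B₃³B₅M^{10}p₀(g_k)q₁(g_k)R_k⁷L^{−N}. (1.47) The last bound
above is small under the usual conditions on N."* — the `g_k`-dependent part `p₀(g_k)q₁(g_k)R_k⁷L^{−N}` of the right-hand
side of `B16Sect1Statements.Ineq147` under the lower window `L^{−N} ≦ ℓ^{−ν}` and the dictionary (`q₁(g_k) = ℓ^{q₁}`):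
`≦ L⁷·ℓ^{p₀ + q₁ + 7r₀ − ν}`. PROVED. The text does not quantify «the usual conditions on N» at this place; the exponent
shows that `ν ≧ p₀ + q₁ + 7r₀ (+κ)` is what is needed (cell GAPS G-B16-03), see the next declaration. [cite: Balaban1989LargeFieldII, (1.47) p.368] -/
theorem window368 {L Linv ℓ ν r₀ p₀ q₁ Rk p₀g q₁g : ℝ} {N : ℕ} (hL : 1 ≤ L) (hLinv : Linv = L⁻¹) (hℓ : 1 ≤ ℓ)
    (hlow : B16Sect1Kernels.NWindowLower L N ℓ ν) (hRk : 0 ≤ Rk) (hRhi : Rk ≤ L * ℓ ^ r₀) (hp₀g : p₀g = ℓ ^ p₀)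
    (hq₁g : q₁g = ℓ ^ q₁) :
    p₀g * q₁g * Rk ^ 7 * Linv ^ N ≤ L ^ 7 * ℓ ^ (p₀ + q₁ + 7 * r₀ - ν) := by
  have hL0 : 0 < L := by linarith
  have hℓ0 : 0 < ℓ := by linarith
  have hlow' : L ^ (-(N : ℝ)) ≤ ℓ ^ (-ν) := hlow
  have f1 : Linv ^ N ≤ ℓ ^ (-ν) := by
    have e : Linv ^ N = L ^ (-(N : ℝ)) := by rw [hLinv, inv_pow, Real.rpow_neg hL0.le, Real.rpow_natCast]
    rw [e]; exact hlow'
  have f3 : Rk ^ 7 ≤ (L * ℓ ^ r₀) ^ 7 := pow_le_pow_left₀ hRk hRhi 7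
  have hLinv0 : 0 ≤ Linv := by rw [hLinv]; positivity
  calc p₀g * q₁g * Rk ^ 7 * Linv ^ N ≤ p₀g * q₁g * (L * ℓ ^ r₀) ^ 7 * ℓ ^ (-ν) := by
        rw [hp₀g, hq₁g]
        exact mul_le_mul (mul_le_mul_of_nonneg_left f3 (by positivity)) f1 (by positivity) (by positivity)
    _ = L ^ 7 * ℓ ^ (p₀ + q₁ + 7 * r₀ - ν) := by
        rw [hp₀g, hq₁g, mul_pow, rpow_pow_eq hℓ0.le]
        have eℓ : ℓ ^ (p₀ + q₁ + 7 * r₀ - ν) = ℓ ^ p₀ * ℓ ^ q₁ * ℓ ^ (r₀ * (7 : ℕ)) * ℓ ^ (-ν) := by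
          rw [← Real.rpow_add hℓ0, ← Real.rpow_add hℓ0, ← Real.rpow_add hℓ0]; congr 1; push_cast; ring
        rw [eℓ]; ring

/-- **(1.47) under an explicit condition on `N`**: if `ν ≧ p₀ + q₁ + 7r₀ + κ` then the `g_k`-dependent part is `≦
L⁷·ℓ^{−κ}`, and `Ineq147` gives `|T| < O(1)A₀C₁B₃³B₅M^{10}·L⁷·ℓ^{−κ}` — bounded uniformly in `g_k` for `κ = 0`, tending
to `0` for `κ > 0` (`rpow_neg_small`). PROVED. [cite: Balaban1989LargeFieldII, (1.47) p.368] -/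
theorem ineq147_window {T C A₀ C₁ B₃ B₅ M L Linv ℓ ν r₀ p₀ q₁ κ Rk p₀g q₁g : ℝ} {N : ℕ} (hL : 1 ≤ L)
    (hLinv : Linv = L⁻¹) (hℓ : 1 ≤ ℓ) (hlow : B16Sect1Kernels.NWindowLower L N ℓ ν) (hRk : 0 ≤ Rk)
    (hRhi : Rk ≤ L * ℓ ^ r₀) (hp₀g : p₀g = ℓ ^ p₀) (hq₁g : q₁g = ℓ ^ q₁) (hν : p₀ + q₁ + 7 * r₀ + κ ≤ ν)
    (hC : 0 ≤ C) (hA₀ : 0 ≤ A₀) (hC₁ : 0 ≤ C₁) (hB₃ : 0 ≤ B₃) (hB₅ : 0 ≤ B₅)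
    (h147 : B16Sect1Statements.Ineq147 T C A₀ C₁ B₃ B₅ M p₀g q₁g Rk Linv N) :
    |T| < C * A₀ * C₁ * B₃ ^ 3 * B₅ * M ^ 10 * (L ^ 7 * ℓ ^ (-κ)) := by
  unfold B16Sect1Statements.Ineq147 at h147
  have hw := window368 hL hLinv hℓ hlow hRk hRhi hp₀g hq₁g
  have hκ : L ^ 7 * ℓ ^ (p₀ + q₁ + 7 * r₀ - ν) ≤ L ^ 7 * ℓ ^ (-κ) :=
    mul_le_mul_of_nonneg_left (rpow_le_rpow_of_le hℓ (by linarith)) (by positivity)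
  have hK : 0 ≤ C * A₀ * C₁ * B₃ ^ 3 * B₅ * M ^ 10 := by positivity
  calc |T| < C * A₀ * C₁ * B₃ ^ 3 * B₅ * M ^ 10 * p₀g * q₁g * Rk ^ 7 * Linv ^ N := h147
    _ = C * A₀ * C₁ * B₃ ^ 3 * B₅ * M ^ 10 * (p₀g * q₁g * Rk ^ 7 * Linv ^ N) := by ring
    _ ≤ C * A₀ * C₁ * B₃ ^ 3 * B₅ * M ^ 10 * (L ^ 7 * ℓ ^ (-κ)) :=
        mul_le_mul_of_nonneg_left (hw.trans hκ) hK

/-! ## §8. p. 379: the first-order term `σ` of `𝐓′_k(X)` is small (row B16.Lem@379) -/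

/-- **p. 379 [25]** (render p025), verbatim: *"… the first order term can be bounded by O(1)B₃²A₁²p₁²(g_k)|𝐁₀|(α_{0,k}
+ α_{1,k}) < O(1)B₃²A₁²C₀M^dR_k^{d+2}p₁²(g_k)q₀(g_k)g_k, and this bound is small."* — PROVED for the right-hand side of
`B16Sect1Statements.sigmaQuad379_arith` (its `O(1)` = `C·100^d`): it is `≦ τ` for `0 < g_k ≦ g₀(τ, …)` (dictionary
`p₁(g_k) = ℓ^{p₁}`, `q₀(g_k) = ℓ^{q₀}`, `R_k ≦ Lℓ^{r₀}`, `g_k = e^{−ℓ/2}`). [cite: Balaban1989LargeFieldII, p.379 (after (1.72))] -/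
theorem sigmaQuad379_small (C B₃ A₁ C₀ M L p₁ q₀ r₀ : ℝ) (d : ℕ) (hC : 0 ≤ C) (hC₀ : 0 ≤ C₀) (hM : 0 ≤ M)
    {τ : ℝ} (hτ : 0 < τ) :
    ∃ g₀ : ℝ, 0 < g₀ ∧ ∀ gk ℓ Rk p₁g q₀g : ℝ, 0 < gk → ℓ = Real.log (gk ^ 2)⁻¹ →
      ℓ ^ r₀ ≤ Rk → Rk ≤ L * ℓ ^ r₀ → gk ≤ g₀ → p₁g = ℓ ^ p₁ → q₀g = ℓ ^ q₀ →
      (C * 100 ^ d) * B₃ ^ 2 * A₁ ^ 2 * C₀ * M ^ d * Rk ^ (d + 2) * p₁g ^ 2 * q₀g * gk ≤ τ := by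
  obtain ⟨ℓ₀, hℓ₀1, hℓ₀⟩ :=
    decay_small (C * 100 ^ d * B₃ ^ 2 * A₁ ^ 2 * C₀ * M ^ d * L ^ (d + 2))
      (r₀ * (d + 2 : ℕ) + p₁ * (2 : ℕ) + q₀) (1 / 2) (by norm_num) hτ
  refine ⟨Real.exp (-(ℓ₀ / 2)), Real.exp_pos _, fun gk ℓ Rk p₁g q₀g hg0 hℓeq hRlo hRhi hg hp₁ hq₀ => ?_⟩
  have hℓ : ℓ₀ ≤ ℓ := by rw [hℓeq]; exact ell_ge_of_g_le hg0 hg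
  have hℓ0 : 0 < ℓ := by linarith
  have hRk : 0 ≤ Rk := le_trans (Real.rpow_nonneg hℓ0.le r₀) hRlo
  have hRpow : Rk ^ (d + 2) ≤ (L * ℓ ^ r₀) ^ (d + 2) := pow_le_pow_left₀ hRk hRhi _
  have hq0 : 0 ≤ q₀g := by rw [hq₀]; exact Real.rpow_nonneg hℓ0.le _
  have e2 : (C * 100 ^ d) * B₃ ^ 2 * A₁ ^ 2 * C₀ * M ^ d * (L * ℓ ^ r₀) ^ (d + 2) * p₁g ^ 2 * q₀g * gk =
      (C * 100 ^ d * B₃ ^ 2 * A₁ ^ 2 * C₀ * M ^ d * L ^ (d + 2)) *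
        ℓ ^ (r₀ * (d + 2 : ℕ) + p₁ * (2 : ℕ) + q₀) * Real.exp (-(1 / 2 * ℓ)) := by
    rw [hp₁, hq₀, mul_pow, Real.rpow_add hℓ0, Real.rpow_add hℓ0, ← rpow_pow_eq hℓ0.le, ← rpow_pow_eq hℓ0.le,
      g_eq_exp_of_ell hg0 hℓeq]
    ring_nf
  calc (C * 100 ^ d) * B₃ ^ 2 * A₁ ^ 2 * C₀ * M ^ d * Rk ^ (d + 2) * p₁g ^ 2 * q₀g * gk
      ≤ (C * 100 ^ d) * B₃ ^ 2 * A₁ ^ 2 * C₀ * M ^ d * (L * ℓ ^ r₀) ^ (d + 2) * p₁g ^ 2 * q₀g * gk := by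
        refine mul_le_mul_of_nonneg_right (mul_le_mul_of_nonneg_right (mul_le_mul_of_nonneg_right ?_ ?_) hq0)
          hg0.le
        · exact mul_le_mul_of_nonneg_left hRpow (by positivity)
        · positivity
    _ = (C * 100 ^ d * B₃ ^ 2 * A₁ ^ 2 * C₀ * M ^ d * L ^ (d + 2)) *
        ℓ ^ (r₀ * (d + 2 : ℕ) + p₁ * (2 : ℕ) + q₀) * Real.exp (-(1 / 2 * ℓ)) := e2
    _ ≤ |C * 100 ^ d * B₃ ^ 2 * A₁ ^ 2 * C₀ * M ^ d * L ^ (d + 2)| *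
        ℓ ^ (r₀ * (d + 2 : ℕ) + p₁ * (2 : ℕ) + q₀) * Real.exp (-(1 / 2 * ℓ)) :=
        bound_by_decay hℓ0.le (Real.exp_pos _).le le_rfl
    _ ≤ τ := hℓ₀ ℓ hℓ

/-! ## §9. Bridges: the tree's typed (2.5) [III] feeds the dictionary; the first-order term of (1.28)
(rows B16.Lem@363, B16.Eq1.6, B16.Txt@363, B16.Eq1.28) -/

/-- **(2.5) p. 255 [III] ⇒ the two-sided dictionary.**  The tree types (2.5) as `B14.IsRj L r g_k R_k` (*"R_j is
the smallest number of the form L^r such, that R_j ≧ (log g_j⁻²)^r"*: `R_k = L^s` for the least `s` with `L^s ≧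
(log g_k⁻²)^r`).  For `ℓ = log g_k⁻² ≧ 1` this gives both halves `ℓ^r ≦ R_k ≦ Lℓ^r` used as hypotheses throughout
this file, with the real exponent `r₀ = r` (lower half: the defining inequality; upper half: minimality of the power,
`B14FlowStep.isRj_le_mul_logpow`). [cite: Balaban1988Convergent, (2.5) p.255] -/
theorem dict_of_isRj {L r : ℕ} (hL : 1 ≤ L) {gk : ℝ} {Rk : ℕ} (hR : B14.IsRj L r gk Rk)
    (hℓ : 1 ≤ Real.log (gk ^ 2)⁻¹) :
    (Real.log (gk ^ 2)⁻¹) ^ (r : ℝ) ≤ (Rk : ℝ) ∧ (Rk : ℝ) ≤ (L : ℝ) * (Real.log (gk ^ 2)⁻¹) ^ (r : ℝ) := by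
  have hP1 : 1 ≤ (Real.log (gk ^ 2)⁻¹) ^ r := one_le_pow₀ hℓ
  have hup := B14FlowStep.isRj_le_mul_logpow hL hR hP1
  obtain ⟨s, _, hlo, _⟩ := hR
  rw [Real.rpow_natCast]
  exact ⟨hlo, hup⟩

/-- The same with the threshold in `g_k`: for `0 < g_k ≦ e^{−1/2}` one has `ℓ = log g_k⁻² ≧ 1` (`ell_ge_of_g_le`),
hence (2.5) [III] gives `ℓ^r ≦ R_k ≦ Lℓ^r`. [cite: Balaban1988Convergent, (2.5) p.255] -/
theorem dict_of_isRj_of_g_le {L r : ℕ} (hL : 1 ≤ L) {gk : ℝ} {Rk : ℕ} (hg0 : 0 < gk)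
    (hg : gk ≤ Real.exp (-(1 / 2))) (hR : B14.IsRj L r gk Rk) :
    (Real.log (gk ^ 2)⁻¹) ^ (r : ℝ) ≤ (Rk : ℝ) ∧ (Rk : ℝ) ≤ (L : ℝ) * (Real.log (gk ^ 2)⁻¹) ^ (r : ℝ) :=
  dict_of_isRj hL hR (ell_ge_of_g_le (ℓ₀ := 1) hg0 hg)

/-- **Row B16.Eq1.6 knit to (2.5) [III] by name**: with `R_k` given by `B14.IsRj L r g_k R_k` (`L ≧ 1`, `r ≧ 1`, [III]
p. 246) and `p₀(g_k) = (log g_k⁻²)^{p₀}`, the bound (1.6) gives `|T| < 1` for `0 < g_k ≦ g₀` — `ineq16_abs_lt_one` with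
its dictionary hypothesis discharged by `dict_of_isRj`. [cite: Balaban1989LargeFieldII, (1.6) p.357] -/
theorem ineq16_abs_lt_one_of_isRj (B₃ M₀ A₀ M p₀ : ℝ) {L r : ℕ} (hL : 1 ≤ L) (hr : 1 ≤ r) :
    ∃ g₀ : ℝ, 0 < g₀ ∧ ∀ (gk p₀g T : ℝ) (Rk : ℕ), 0 < gk → gk ≤ g₀ → B14.IsRj L r gk Rk →
      p₀g = (Real.log (gk ^ 2)⁻¹) ^ p₀ → B16Sect1Wilson.Ineq16 T B₃ M₀ A₀ p₀g Rk M → |T| < 1 := by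
  obtain ⟨g₀, hg₀, h⟩ := ineq16_abs_lt_one B₃ M₀ A₀ M p₀ (r : ℝ) (by exact_mod_cast hr)
  refine ⟨min g₀ (Real.exp (-(1 / 2))), lt_min hg₀ (Real.exp_pos _), fun gk p₀g T Rk hg0 hg hR hp h16 => ?_⟩
  obtain ⟨hlo, -⟩ := dict_of_isRj_of_g_le hL hg0 (le_trans hg (min_le_right _ _)) hR
  exact h gk _ (Rk : ℝ) p₀g T hg0 rfl hlo (le_trans hg (min_le_left _ _)) hp h16

/-- **p. 363 [9]** (render p009), the first-order term of the expansion of (1.28) in `𝐇_{𝐁₁}`: *"hence the first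
order term in this expansion can be bounded by this number multiplied by the right-hand side of the inequality (1.23),
and by some absolute constant. Thus the first order term of this expansion is small,"* — PROVED for the bound of
`B16Sect1Statements.Ineq128first` divided by `g_k²`: with `ε_k = g_kA₀p₀(g_k)` inside the right-hand side
`B16Sect1Statements.rhs123` of (1.23), `R_k ≦ R_{h+1}` and `δM > 0`, the factor `exp(−δMR_{h+1}) ≦ exp(−δMℓ)` kills
the polynomial growth `R_k^{d+β₀}p₀³(g_k)`: the number is `≦ τ` for `0 < g_k ≦ g₀(τ, …)` (dictionary `p₀(g_k) =
ℓ^{p₀}`, `ℓ^{r₀} ≦ R_k ≦ Lℓ^{r₀}`, `r₀ ≧ 1`). [cite: Balaban1989LargeFieldII, (1.28) p.363] -/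
theorem ineq128first_small (C C' A₀ B₃ B₅ M δ β₀ L p₀ r₀ : ℝ) (d : ℕ) (hC : 0 ≤ C) (hC' : 0 ≤ C') (hA₀ : 0 ≤ A₀)
    (hB₃ : 0 ≤ B₃) (hB₅ : 0 ≤ B₅) (hM : 0 < M) (hδ : 0 < δ) (hβ₀ : 0 ≤ β₀) (hL : 0 ≤ L) (hr₀ : 1 ≤ r₀) {τ : ℝ}
    (hτ : 0 < τ) :
    ∃ g₀ : ℝ, 0 < g₀ ∧ ∀ gk ℓ Rk Rh1 p₀g εk : ℝ, 0 < gk → ℓ = Real.log (gk ^ 2)⁻¹ →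
      ℓ ^ r₀ ≤ Rk → Rk ≤ L * ℓ ^ r₀ → Rk ≤ Rh1 → gk ≤ g₀ → p₀g = ℓ ^ p₀ → εk = gk * A₀ * p₀g →
      (gk ^ 2)⁻¹ * ((gk ^ 2 * C * A₀ ^ 2 * B₃ ^ 2 * B₅ * M ^ (d + 5) * Rk ^ d * p₀g ^ 2) *
        B16Sect1Statements.rhs123 B₃ δ M Rh1 d β₀ Rk εk * C') ≤ τ := by
  have hc : 0 < δ * M := by positivity
  have hK0 : 0 ≤ C * A₀ ^ 2 * B₃ ^ 2 * B₅ * M ^ (d + 5) * (B₃ * (11 * (d : ℝ) ^ 2 * (1 + β₀) ^ 2)) * C' * A₀ := by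
    positivity
  obtain ⟨ℓ₀, hℓ₀1, hℓ₀⟩ :=
    decay_small (C * A₀ ^ 2 * B₃ ^ 2 * B₅ * M ^ (d + 5) * (B₃ * (11 * (d : ℝ) ^ 2 * (1 + β₀) ^ 2)) * C' * A₀ *
      (L ^ d * L ^ β₀)) (r₀ * (d : ℕ) + r₀ * β₀ + p₀ * (3 : ℕ)) (δ * M) hc hτ
  refine ⟨Real.exp (-(ℓ₀ / 2)), Real.exp_pos _, fun gk ℓ Rk Rh1 p₀g εk hg0 hℓeq hRlo hRhi hRh hg hp₀ hε => ?_⟩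
  have hℓ : ℓ₀ ≤ ℓ := by rw [hℓeq]; exact ell_ge_of_g_le hg0 hg
  have hℓ1 : 1 ≤ ℓ := le_trans hℓ₀1 hℓ
  have hℓ0 : 0 < ℓ := by linarith
  have hRk : 0 ≤ Rk := le_trans (Real.rpow_nonneg hℓ0.le r₀) hRlo
  have hR : ℓ ≤ Rk := le_trans (ell_le_rpow hℓ1 hr₀) hRlo
  have hp0g : 0 ≤ p₀g := by rw [hp₀]; exact Real.rpow_nonneg hℓ0.le _
  have hg1 : gk ≤ 1 := by
    refine le_trans hg ?_
    rw [← Real.exp_zero]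
    exact Real.exp_le_exp.mpr (by linarith)
  have hexp : Real.exp (-(δ * M * Rh1)) ≤ Real.exp (-(δ * M * ℓ)) := by
    apply Real.exp_le_exp.mpr
    have : δ * M * ℓ ≤ δ * M * Rh1 := mul_le_mul_of_nonneg_left (le_trans hR hRh) hc.le
    linarith
  have hRd : Rk ^ d ≤ (L * ℓ ^ r₀) ^ d := pow_le_pow_left₀ hRk hRhi _
  have hRβ : Rk ^ β₀ ≤ (L * ℓ ^ r₀) ^ β₀ := Real.rpow_le_rpow hRk hRhi hβ₀
  have hX0 : 0 ≤ Rk ^ d * Rk ^ β₀ * p₀g ^ 3 := by positivity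
  have hX : gk * (Rk ^ d * Rk ^ β₀ * p₀g ^ 3) ≤ 1 * ((L * ℓ ^ r₀) ^ d * (L * ℓ ^ r₀) ^ β₀ * p₀g ^ 3) := by
    refine mul_le_mul hg1 ?_ hX0 zero_le_one
    refine mul_le_mul_of_nonneg_right (mul_le_mul hRd hRβ (Real.rpow_nonneg hRk _) (by positivity)) ?_
    positivity
  have hg2 : gk ^ 2 ≠ 0 := by positivity
  have e0 : (gk ^ 2)⁻¹ * ((gk ^ 2 * C * A₀ ^ 2 * B₃ ^ 2 * B₅ * M ^ (d + 5) * Rk ^ d * p₀g ^ 2) *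
      B16Sect1Statements.rhs123 B₃ δ M Rh1 d β₀ Rk εk * C') =
      (C * A₀ ^ 2 * B₃ ^ 2 * B₅ * M ^ (d + 5) * Rk ^ d * p₀g ^ 2) *
        B16Sect1Statements.rhs123 B₃ δ M Rh1 d β₀ Rk εk * C' := by
    rw [show (gk ^ 2 * C * A₀ ^ 2 * B₃ ^ 2 * B₅ * M ^ (d + 5) * Rk ^ d * p₀g ^ 2) *
        B16Sect1Statements.rhs123 B₃ δ M Rh1 d β₀ Rk εk * C' =
        gk ^ 2 * ((C * A₀ ^ 2 * B₃ ^ 2 * B₅ * M ^ (d + 5) * Rk ^ d * p₀g ^ 2) *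
          B16Sect1Statements.rhs123 B₃ δ M Rh1 d β₀ Rk εk * C') by ring, inv_mul_cancel_left₀ hg2]
  have e1 : (C * A₀ ^ 2 * B₃ ^ 2 * B₅ * M ^ (d + 5) * Rk ^ d * p₀g ^ 2) *
      B16Sect1Statements.rhs123 B₃ δ M Rh1 d β₀ Rk εk * C' =
      (C * A₀ ^ 2 * B₃ ^ 2 * B₅ * M ^ (d + 5) * (B₃ * (11 * (d : ℝ) ^ 2 * (1 + β₀) ^ 2)) * C' * A₀) *
        (gk * (Rk ^ d * Rk ^ β₀ * p₀g ^ 3)) * Real.exp (-(δ * M * Rh1)) := by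
    rw [hε]
    simp only [B16Sect1Statements.rhs123]
    ring
  have e2 : (C * A₀ ^ 2 * B₃ ^ 2 * B₅ * M ^ (d + 5) * (B₃ * (11 * (d : ℝ) ^ 2 * (1 + β₀) ^ 2)) * C' * A₀) *
      (1 * ((L * ℓ ^ r₀) ^ d * (L * ℓ ^ r₀) ^ β₀ * p₀g ^ 3)) * Real.exp (-(δ * M * Rh1)) =
      (C * A₀ ^ 2 * B₃ ^ 2 * B₅ * M ^ (d + 5) * (B₃ * (11 * (d : ℝ) ^ 2 * (1 + β₀) ^ 2)) * C' * A₀ *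
        (L ^ d * L ^ β₀)) * ℓ ^ (r₀ * (d : ℕ) + r₀ * β₀ + p₀ * (3 : ℕ)) * Real.exp (-(δ * M * Rh1)) := by
    rw [hp₀, mul_pow, Real.mul_rpow hL (Real.rpow_nonneg hℓ0.le r₀), ← Real.rpow_mul hℓ0.le,
      Real.rpow_add hℓ0, Real.rpow_add hℓ0, ← rpow_pow_eq hℓ0.le, ← rpow_pow_eq hℓ0.le]
    ring
  rw [e0, e1]
  calc (C * A₀ ^ 2 * B₃ ^ 2 * B₅ * M ^ (d + 5) * (B₃ * (11 * (d : ℝ) ^ 2 * (1 + β₀) ^ 2)) * C' * A₀) *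
        (gk * (Rk ^ d * Rk ^ β₀ * p₀g ^ 3)) * Real.exp (-(δ * M * Rh1))
      ≤ (C * A₀ ^ 2 * B₃ ^ 2 * B₅ * M ^ (d + 5) * (B₃ * (11 * (d : ℝ) ^ 2 * (1 + β₀) ^ 2)) * C' * A₀) *
        (1 * ((L * ℓ ^ r₀) ^ d * (L * ℓ ^ r₀) ^ β₀ * p₀g ^ 3)) * Real.exp (-(δ * M * Rh1)) :=
        mul_le_mul_of_nonneg_right (mul_le_mul_of_nonneg_left hX hK0) (Real.exp_pos _).le
    _ = (C * A₀ ^ 2 * B₃ ^ 2 * B₅ * M ^ (d + 5) * (B₃ * (11 * (d : ℝ) ^ 2 * (1 + β₀) ^ 2)) * C' * A₀ *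
        (L ^ d * L ^ β₀)) * ℓ ^ (r₀ * (d : ℕ) + r₀ * β₀ + p₀ * (3 : ℕ)) * Real.exp (-(δ * M * Rh1)) := e2
    _ ≤ |C * A₀ ^ 2 * B₃ ^ 2 * B₅ * M ^ (d + 5) * (B₃ * (11 * (d : ℝ) ^ 2 * (1 + β₀) ^ 2)) * C' * A₀ *
        (L ^ d * L ^ β₀)| * ℓ ^ (r₀ * (d : ℕ) + r₀ * β₀ + p₀ * (3 : ℕ)) * Real.exp (-(δ * M * ℓ)) :=
        bound_by_decay hℓ0.le (Real.exp_pos _).le hexp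
    _ ≤ τ := hℓ₀ ℓ hℓ

/-- The first-order term itself: `Ineq128first` ⇒ `|T₁|/g_k² ≦ τ` for `0 < g_k ≦ g₀(τ, …)` — p. 363 *"Thus the first
order term of this expansion is small"*. [cite: Balaban1989LargeFieldII, (1.28) p.363] -/
theorem ineq128first_div_small (C C' A₀ B₃ B₅ M δ β₀ L p₀ r₀ : ℝ) (d : ℕ) (hC : 0 ≤ C) (hC' : 0 ≤ C')
    (hA₀ : 0 ≤ A₀) (hB₃ : 0 ≤ B₃) (hB₅ : 0 ≤ B₅) (hM : 0 < M) (hδ : 0 < δ) (hβ₀ : 0 ≤ β₀) (hL : 0 ≤ L)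
    (hr₀ : 1 ≤ r₀) {τ : ℝ} (hτ : 0 < τ) :
    ∃ g₀ : ℝ, 0 < g₀ ∧ ∀ gk ℓ Rk Rh1 p₀g εk T₁ : ℝ, 0 < gk → ℓ = Real.log (gk ^ 2)⁻¹ →
      ℓ ^ r₀ ≤ Rk → Rk ≤ L * ℓ ^ r₀ → Rk ≤ Rh1 → gk ≤ g₀ → p₀g = ℓ ^ p₀ → εk = gk * A₀ * p₀g →
      B16Sect1Statements.Ineq128first T₁ gk C A₀ B₃ B₅ M Rk p₀g d δ Rh1 β₀ εk C' → |T₁| / gk ^ 2 ≤ τ := by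
  obtain ⟨g₀, hg₀, h⟩ := ineq128first_small C C' A₀ B₃ B₅ M δ β₀ L p₀ r₀ d hC hC' hA₀ hB₃ hB₅ hM hδ hβ₀ hL hr₀ hτ
  refine ⟨g₀, hg₀, fun gk ℓ Rk Rh1 p₀g εk T₁ hg0 hℓeq hRlo hRhi hRh hg hp₀ hε h1 => ?_⟩
  have hg2 : 0 < gk ^ 2 := by positivity
  have := h gk ℓ Rk Rh1 p₀g εk hg0 hℓeq hRlo hRhi hRh hg hp₀ hε
  rw [div_eq_inv_mul]
  exact le_trans (mul_le_mul_of_nonneg_left h1 (inv_pos.mpr hg2).le) this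


/-! ## §10. p. 358 «for g_k sufficiently small» at (1.9) and p. 383 «g_j sufficiently small» at (1.77)
(rows B16.Eq1.9, B16.Eq1.77) -/

/-- **(1.7) → (1.9), p. 358 [4]** (render p004): *"The inequalities (1.7), (1.8) imply finally … (1.9) for g_k
sufficiently small."* — the correction of (1.7), `O(1)(M⁶R_kε_k + exp(−R_k))`, is `≦ τ` for `0 < g_k ≦ g₀(τ, …)`:
with `ε_k = g_kA₀p₀(g_k) = e^{−ℓ/2}A₀ℓ^{p₀}` and `R_k ≦ Lℓ^{r₀}` the first summand is a polylog times `e^{−ℓ/2}`, and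
`exp(−R_k) ≦ exp(−ℓ)` (`R_k ≧ ℓ^{r₀} ≧ ℓ`, `r₀ ≧ 1`). PROVED. [cite: Balaban1989LargeFieldII, (1.7)–(1.9) p.358] -/
theorem ineq17_correction_small (C M A₀ L p₀ r₀ : ℝ) (hC : 0 ≤ C) (hA₀ : 0 ≤ A₀) (hr₀ : 1 ≤ r₀) {τ : ℝ}
    (hτ : 0 < τ) :
    ∃ g₀ : ℝ, 0 < g₀ ∧ ∀ gk ℓ Rk p₀g εk : ℝ, 0 < gk → ℓ = Real.log (gk ^ 2)⁻¹ →
      ℓ ^ r₀ ≤ Rk → Rk ≤ L * ℓ ^ r₀ → gk ≤ g₀ → p₀g = ℓ ^ p₀ → εk = gk * A₀ * p₀g →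
      C * (M ^ 6 * Rk * εk + Real.exp (-Rk)) ≤ τ := by
  have hτ2 : 0 < τ / 2 := by linarith
  obtain ⟨ℓ₁, hℓ₁1, hℓ₁⟩ := decay_small (C * M ^ 6 * L * A₀) (r₀ + p₀) (1 / 2) (by norm_num) hτ2
  obtain ⟨ℓ₂, hℓ₂1, hℓ₂⟩ := decay_small C 0 1 one_pos hτ2
  refine ⟨Real.exp (-(max ℓ₁ ℓ₂ / 2)), Real.exp_pos _, fun gk ℓ Rk p₀g εk hg0 hℓeq hRlo hRhi hg hp₀ hε => ?_⟩
  have hℓ : max ℓ₁ ℓ₂ ≤ ℓ := by rw [hℓeq]; exact ell_ge_of_g_le hg0 hg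
  have hℓa : ℓ₁ ≤ ℓ := le_trans (le_max_left _ _) hℓ
  have hℓb : ℓ₂ ≤ ℓ := le_trans (le_max_right _ _) hℓ
  have hℓ1 : 1 ≤ ℓ := le_trans hℓ₁1 hℓa
  have hℓ0 : 0 < ℓ := by linarith
  have hR : ℓ ≤ Rk := le_trans (ell_le_rpow hℓ1 hr₀) hRlo
  have hp0g : 0 ≤ p₀g := by rw [hp₀]; exact Real.rpow_nonneg hℓ0.le _
  have hεk : 0 ≤ εk := by rw [hε]; positivity
  have t1 : C * (M ^ 6 * Rk * εk) ≤ τ / 2 := by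
    have e : C * (M ^ 6 * (L * ℓ ^ r₀) * εk) =
        (C * M ^ 6 * L * A₀) * ℓ ^ (r₀ + p₀) * Real.exp (-(1 / 2 * ℓ)) := by
      rw [hε, hp₀, Real.rpow_add hℓ0, g_eq_exp_of_ell hg0 hℓeq]
      ring_nf
    calc C * (M ^ 6 * Rk * εk) ≤ C * (M ^ 6 * (L * ℓ ^ r₀) * εk) :=
          mul_le_mul_of_nonneg_left
            (mul_le_mul_of_nonneg_right (mul_le_mul_of_nonneg_left hRhi (by positivity)) hεk) hC
      _ = (C * M ^ 6 * L * A₀) * ℓ ^ (r₀ + p₀) * Real.exp (-(1 / 2 * ℓ)) := e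
      _ ≤ |C * M ^ 6 * L * A₀| * ℓ ^ (r₀ + p₀) * Real.exp (-(1 / 2 * ℓ)) :=
          bound_by_decay hℓ0.le (Real.exp_pos _).le le_rfl
      _ ≤ τ / 2 := hℓ₁ ℓ hℓa
  have t2 : C * Real.exp (-Rk) ≤ τ / 2 := by
    have hexp : Real.exp (-Rk) ≤ Real.exp (-(1 * ℓ)) := Real.exp_le_exp.mpr (by linarith)
    calc C * Real.exp (-Rk) = C * ℓ ^ (0 : ℝ) * Real.exp (-Rk) := by rw [Real.rpow_zero]; ring
      _ ≤ |C| * ℓ ^ (0 : ℝ) * Real.exp (-(1 * ℓ)) := bound_by_decay hℓ0.le (Real.exp_pos _).le hexp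
      _ ≤ τ / 2 := hℓ₂ ℓ hℓb
  calc C * (M ^ 6 * Rk * εk + Real.exp (-Rk)) = C * (M ^ 6 * Rk * εk) + C * Real.exp (-Rk) := by ring
    _ ≤ τ / 2 + τ / 2 := add_le_add t1 t2
    _ = τ := by ring

/-- **(1.9) for g_k sufficiently small, p. 358 [4]**: with `γ₀ > 0`, `M > 0`, `d ≧ 1` fixed there is `g₀ > 0` such that
for `0 < g_k ≦ g₀` (dictionary as above) the inequalities (1.7) `B16Sect1Wilson.Ineq17` and (1.8)
`B16Sect1Wilson.Ineq18` imply (1.9) `B16Sect1Wilson.Ineq19` — the sibling's `ineq19_of_17_18` with its explicit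
smallness hypothesis `O(1)(M⁶R_kε_k + e^{−R_k}) ≦ γ₀/(2d(100M)^{d+1})` DISCHARGED by `ineq17_correction_small`.
[cite: Balaban1989LargeFieldII, (1.9) p.358] -/
theorem ineq19_of_17_18_small (C M A₀ L p₀ r₀ γ₀ : ℝ) (d : ℕ) (hd : 1 ≤ d) (hC : 0 ≤ C) (hM : 0 < M)
    (hA₀ : 0 ≤ A₀) (hr₀ : 1 ≤ r₀) (hγ : 0 < γ₀) :
    ∃ g₀ : ℝ, 0 < g₀ ∧ ∀ gk ℓ Rk p₀g εk Q ndB nB : ℝ, 0 < gk → ℓ = Real.log (gk ^ 2)⁻¹ →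
      ℓ ^ r₀ ≤ Rk → Rk ≤ L * ℓ ^ r₀ → gk ≤ g₀ → p₀g = ℓ ^ p₀ → εk = gk * A₀ * p₀g → 0 ≤ nB →
      B16Sect1Wilson.Ineq17 Q ndB nB γ₀ C M Rk εk → B16Sect1Wilson.Ineq18 nB ndB d M →
      B16Sect1Wilson.Ineq19 Q nB γ₀ d M := by
  have hd0 : (0 : ℝ) < d := by exact_mod_cast hd
  have hτ : 0 < γ₀ / (2 * d * (100 * M) ^ (d + 1)) := by positivity
  obtain ⟨g₀, hg₀, h⟩ := ineq17_correction_small C M A₀ L p₀ r₀ hC hA₀ hr₀ hτ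
  exact ⟨g₀, hg₀, fun gk ℓ Rk p₀g εk Q ndB nB hg0 hℓeq hRlo hRhi hg hp₀ hε hnB h17 h18 =>
    B16Sect1Wilson.ineq19_of_17_18 hd hM hγ.le hnB h17 h18 (h gk ℓ Rk p₀g εk hg0 hℓeq hRlo hRhi hg hp₀ hε)⟩

/-- **(1.77), p. 383 [29]** (render p029): *"… − O(1)A₀A₁²B₃⁴B₅M^{d+6}R_j^{d+3}p₀(g_j)p₁²(g_j)g_j. (1.77) We assume
that g_j is sufficiently small, so that the constant on the right-hand side above is small, or O(1)."* — PROVED: the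
constant of `B16Sect1Kernels.Ineq177` is `≦ τ` for `0 < g_j ≦ g₀(τ, …)` (dictionary at scale `j`: `p₀(g_j) = ℓ^{p₀}`,
`p₁(g_j) = ℓ^{p₁}`, `ℓ^{r₀} ≦ R_j ≦ Lℓ^{r₀}`, `g_j = e^{−ℓ/2}`, `ℓ = log g_j⁻²`). [cite: Balaban1989LargeFieldII, (1.77) p.383] -/
theorem ineq177_const_small (C A₀ A₁ B₃ B₅ M L p₀ p₁ r₀ : ℝ) (d : ℕ) (hC : 0 ≤ C) (hA₀ : 0 ≤ A₀) (hB₅ : 0 ≤ B₅)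
    (hM : 0 ≤ M) {τ : ℝ} (hτ : 0 < τ) :
    ∃ g₀ : ℝ, 0 < g₀ ∧ ∀ gj ℓ Rj p₀g p₁g : ℝ, 0 < gj → ℓ = Real.log (gj ^ 2)⁻¹ →
      ℓ ^ r₀ ≤ Rj → Rj ≤ L * ℓ ^ r₀ → gj ≤ g₀ → p₀g = ℓ ^ p₀ → p₁g = ℓ ^ p₁ →
      C * A₀ * A₁ ^ 2 * B₃ ^ 4 * B₅ * M ^ (d + 6) * Rj ^ (d + 3) * p₀g * p₁g ^ 2 * gj ≤ τ := by
  obtain ⟨ℓ₀, hℓ₀1, hℓ₀⟩ :=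
    decay_small (C * A₀ * A₁ ^ 2 * B₃ ^ 4 * B₅ * M ^ (d + 6) * L ^ (d + 3))
      (r₀ * (d + 3 : ℕ) + p₀ + p₁ * (2 : ℕ)) (1 / 2) (by norm_num) hτ
  refine ⟨Real.exp (-(ℓ₀ / 2)), Real.exp_pos _, fun gj ℓ Rj p₀g p₁g hg0 hℓeq hRlo hRhi hg hp₀ hp₁ => ?_⟩
  have hℓ : ℓ₀ ≤ ℓ := by rw [hℓeq]; exact ell_ge_of_g_le hg0 hg
  have hℓ0 : 0 < ℓ := by linarith
  have hRj : 0 ≤ Rj := le_trans (Real.rpow_nonneg hℓ0.le r₀) hRlo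
  have hRpow : Rj ^ (d + 3) ≤ (L * ℓ ^ r₀) ^ (d + 3) := pow_le_pow_left₀ hRj hRhi _
  have hp0 : 0 ≤ p₀g := by rw [hp₀]; exact Real.rpow_nonneg hℓ0.le _
  have e2 : C * A₀ * A₁ ^ 2 * B₃ ^ 4 * B₅ * M ^ (d + 6) * (L * ℓ ^ r₀) ^ (d + 3) * p₀g * p₁g ^ 2 * gj =
      (C * A₀ * A₁ ^ 2 * B₃ ^ 4 * B₅ * M ^ (d + 6) * L ^ (d + 3)) *
        ℓ ^ (r₀ * (d + 3 : ℕ) + p₀ + p₁ * (2 : ℕ)) * Real.exp (-(1 / 2 * ℓ)) := by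
    rw [hp₀, hp₁, mul_pow, Real.rpow_add hℓ0, Real.rpow_add hℓ0, ← rpow_pow_eq hℓ0.le, ← rpow_pow_eq hℓ0.le,
      g_eq_exp_of_ell hg0 hℓeq]
    ring_nf
  calc C * A₀ * A₁ ^ 2 * B₃ ^ 4 * B₅ * M ^ (d + 6) * Rj ^ (d + 3) * p₀g * p₁g ^ 2 * gj
      ≤ C * A₀ * A₁ ^ 2 * B₃ ^ 4 * B₅ * M ^ (d + 6) * (L * ℓ ^ r₀) ^ (d + 3) * p₀g * p₁g ^ 2 * gj := by
        refine mul_le_mul_of_nonneg_right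
          (mul_le_mul_of_nonneg_right (mul_le_mul_of_nonneg_right ?_ hp0) (by positivity)) hg0.le
        exact mul_le_mul_of_nonneg_left hRpow (by positivity)
    _ = (C * A₀ * A₁ ^ 2 * B₃ ^ 4 * B₅ * M ^ (d + 6) * L ^ (d + 3)) *
        ℓ ^ (r₀ * (d + 3 : ℕ) + p₀ + p₁ * (2 : ℕ)) * Real.exp (-(1 / 2 * ℓ)) := e2
    _ ≤ |C * A₀ * A₁ ^ 2 * B₃ ^ 4 * B₅ * M ^ (d + 6) * L ^ (d + 3)| *
        ℓ ^ (r₀ * (d + 3 : ℕ) + p₀ + p₁ * (2 : ℕ)) * Real.exp (-(1 / 2 * ℓ)) :=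
        bound_by_decay hℓ0.le (Real.exp_pos _).le le_rfl
    _ ≤ τ := hℓ₀ ℓ hℓ

/-- The printed alternative *"… or O(1)"* at (1.77): in particular the constant is `≦ 1` for `g_j` small, so (1.77)
gives `Q > γ₀Σ|∂B|² − 1`. [cite: Balaban1989LargeFieldII, (1.77) p.383] -/
theorem ineq177_lower_of_small (C A₀ A₁ B₃ B₅ M L p₀ p₁ r₀ : ℝ) (d : ℕ) (hC : 0 ≤ C) (hA₀ : 0 ≤ A₀)
    (hB₅ : 0 ≤ B₅) (hM : 0 ≤ M) :
    ∃ g₀ : ℝ, 0 < g₀ ∧ ∀ gj ℓ Rj p₀g p₁g γ₀ Q ndB : ℝ, 0 < gj → ℓ = Real.log (gj ^ 2)⁻¹ →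
      ℓ ^ r₀ ≤ Rj → Rj ≤ L * ℓ ^ r₀ → gj ≤ g₀ → p₀g = ℓ ^ p₀ → p₁g = ℓ ^ p₁ →
      B16Sect1Kernels.Ineq177 Q ndB γ₀ C A₀ A₁ B₃ B₅ M Rj p₀g p₁g gj d → γ₀ * ndB - 1 < Q := by
  obtain ⟨g₀, hg₀, h⟩ := ineq177_const_small C A₀ A₁ B₃ B₅ M L p₀ p₁ r₀ d hC hA₀ hB₅ hM one_pos
  refine ⟨g₀, hg₀, fun gj ℓ Rj p₀g p₁g γ₀ Q ndB hg0 hℓeq hRlo hRhi hg hp₀ hp₁ h177 => ?_⟩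
  have hc := h gj ℓ Rj p₀g p₁g hg0 hℓeq hRlo hRhi hg hp₀ hp₁
  unfold B16Sect1Kernels.Ineq177 at h177
  linarith


end Literature.MathematicalPhysics.QuantumFieldTheory.Balaban1983to89.B16Sect1SmallFactors
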